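import Literature.MathematicalPhysics.QuantumFieldTheory.Balaban1983to89.Beta.ResolventComposition

/-!
# Composition of the block-averaging resolvent kernels across averaging levels — step (B): (K1aᵀ) at every level

Node `BETA-an5-g13-RESOLVENT-COMPOSITION` of the β-function sub-cell of the Bałaban audit, companion leaf of
`Beta/ResolventComposition` (v4, p189776; §1–§8 there).  This file is its §9 = v5 content, split off ONLY because the
one-writer leaf exceeded the gate's 200 kB content limit; nothing in `Beta/ResolventComposition` is restated or changed.

HONEST FRAMING (cell rule, verbatim).  Discharging `FlowStep.BetaPertH` would make Bałaban's ultraviolet stability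
theorem UNCONDITIONAL — a real constructive-QFT result; it is NOT the continuum limit and NOT the Clay Millennium
problem.  This file is lattice linear algebra / discrete analysis over the typed objects of the `Beta/` tree.  Every
statement is [folklore] and kernel-checked; NO published theorem is cited as a hypothesis, NO `Prop` is minted as a
named fact, and the manuscripts under audit are used for ORIENTATION ONLY (ABSOLUTE RULE of the cell: no
internally-minted statement enters as a cited fact; the manuscripts are not citable for their own disputed steps).

## What is here

**THE TRANSVERSE COVARIANCE TELESCOPING (K1aᵀ) HOLDS AT EVERY STEP `j`** — `k1aTrans : ResolventComposition.K1aTrans L j`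
(every `L ≥ 1`, every `d`), hence the K1 trio `k1_trio : K1b′ L j ∧ K1cNeg L j ∧ K1aTrans L j` — the three predicates of
`Beta/ResolventComposition` §4 that the composition layer binds BY NAME (lead ruling R26; `k1b'`, `k1cNeg` are
`Beta/ResolventComposition` §6).  Recall (K1aᵀ): for finitely supported CO-CLOSED test 1-forms `F`, `F′`,
`⟨F, Γ_{L^{j+1}} F′⟩ = ⟨F, (Γ_{L^j} − [KInv_{L^j} ∘ ι(C^{(j)}) ∘ KInv_{L^j}]_{(inl,inl)}) F′⟩`; the ENTRYWISE versions
(K1a′)/(K1a⁻) are false for `j ≥ 1` (gauge-slice defect, `Beta/ResolventComposition` §4–§5 and the node's NUMERICS.md),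
the telescoping holds exactly on the transverse (physical, co-closed) slice.

The mechanism, for `N′ = ML` (`M = L^j`): the SUPERPOSITION `V = Γ_{N′} 𝒬_Mᵀ ζ′` of contour-summed covariance columns
with coefficients `ζ′ = ℋ_Mᵀ F′` (coarse co-closed by `Beta/ResolventComposition` §8 (S2); `VF`, `fVF_eq`) satisfies
(EL) with force `𝒬_Mᵀ ζ′` and — because that force is co-closed — NO GAUGE TERM (`gaugeMult_eq_zero`, the §1/§7 energy
argument run on an infinite absolutely convergent superposition, §9.2–§9.3); the general two-level decomposition
`decomposition_of_EL` (the §6/§7 Green-pairing engine, now for any bounded summable field with (EL)+(G)) together with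
(Q) of `Γ_M` writes `V` as a PURE superposition of level-`M` minimisers with coefficients `𝒬_M V = GQ ζ′` (`VF_decomp`,
`contourSum_VF`); pairing with `F` once through this decomposition (`pairF_VF_decomp`) and once directly through the
finite decomposition (A) of `Γ_{N′} F` (`Beta/ResolventComposition` §7, `pairF_VF_direct`) gives the TRANSVERSE PAIRING
IDENTITY `Σ F (Γ_{N′} − Γ_M) F′ = Σ′ ζ_F · (GQ ζ_{F′})` (`pairing_identity`), which is exactly the `(inl, inl)` entry of
`KInv_M ∘ ι(KInvStep) ∘ KInv_M` paired with `F`, `F′` (`compA_apply`, `pair_PQ`).  All exchanges of sums are justified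
by absolute convergence from the exponential decay of `Γ`, `ℋ`, `GamM` (§9.2).  Numerical evidence (exact to rounding on
the periodised torus; NOT load-bearing) is in the node's `NUMERICS.md` v2.

What remains (not in this file, not claimed): nothing of the K1 trio.  (K1c′) and the bundle `KKTComposable` stay
REFUTED as typed (`Beta/ResolventComposition` §5).

VERSIONS.  v1 (p190388) = the §9 announced as "v5" in the node journal; `Beta/ResolventComposition` v1 (p188919),
v1.1 (p189058), v2 (p189188), v3 (p189420), v4 (p189776), v4.1 (p190442), v4.2 (label erratum).  v1.1 (this file, an5
gen 14): DOCSTRINGS ONLY — the orientation-source labels of this header corrected (ERRATUM under Sources); every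
declaration byte-identical to v1.

Sources [orientation only; nothing is cited as a hypothesis]: [B5] = T. Bałaban, Propagators and renormalization
transformations for lattice gauge theories. I, Commun. Math. Phys. 95 (1984) 17–40, §1 — the averaging operation,
the axial gauge conditions and the renormalization transformation (1.8)–(1.14) (p. 19), the constrained variational
problem / minimal configuration §1 D (1.47)–(1.50) (p. 26), and «This defines the operator H_kB = A» (1.59)–(1.60)
(p. 28). ERRATUM (v1.1, docstring only; XREAD C-sb14-53 DOCFIX D1, strat-b14-g20, journal l.54336): the earlier
versions labelled these orientation windows «[B12] = Commun. Math. Phys. 122 (1989) 175–202, §1» and «[B09] = Commun.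
Math. Phys. 116 (1988) 1–22, §1 (1.7)–(1.12)»; in `HOME/inputs/INDEX.md` CMP 122:175–202 is B15 (large field
renormalization I) and CMP 116:1–22 is B13 (cluster expansions), and neither §1 contains the windows meant — the objects of
this file (block averaging Q, gauge slice, constrained minimiser H, fluctuation covariance) are those of B5 §1. Nothing was or
is cited from any of these papers; no declaration changed.
-/

namespace Literature.MathematicalPhysics.QuantumFieldTheory.Balaban1983to89.Beta.ResolventCompositionStepB

noncomputable section

open Literature.Probability.LatticeModels (TorusSite Torus.proj Torus.proj_apply)
open AffineAveraging (Form0 Form1 Form2 unitVec unitVec_apply dz curv curvAdj codiff₁ box toSite blockSum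
  contourSum)
open AffineReproduction (contourSumAdj IsBlockConst)
open LatticeForm (repZ quo proj_repZ)
open BlochFibreUniqueness (quo_add_zsmul quo_repZ)
open KernelSpecInstance (wH wΦ wM wH_EL wH_G wH_Q decay_wH decay_wM decay_wΦ codiff₁_add opEL_shift opG_shift
  opM_shift contourSum_shift contourSumAdj_shift)
open KKTFluctuationKernel (Gam GamΦ GamM delta1 delta1_apply Gam_EL Gam_G GamM_M Gam_Q decay_Gam decay_wΓμ)
open KKTFluctuationEnergy (lip0 lip1 lip2 lip2_comm summable_shift summable_shift_sub summable_mul_of_bdd summable_of_exp_bound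
  summable_mul_of_bdd' abs_dz_le abs_codiff₁_le abs_curv_le abs_contourSumAdj_le summable_dz summable_codiff₁ summable_curv lip1_add
  lip1_curvAdj lip1_dz lip0_codiff₁ tsum_mul_eq_zero_of_blockConst quo_zsmul_add_toSite contourSumAdj_eq
  lip1_contourSumAdj Gcol Mcol Φcol δcol curvAdj_curv_Gcol Gcol_bdd_summable Mcol_bdd_summable Φcol_bdd
  lip1_Gcol_contourSumAdj lip1_Gcol_gauge lip1_Gcol_δcol)
open KKTFluctuationUnique (SolvesKKT Tempered0 Tempered1 unique_of_solvesKKT wM_M solvesKKT_wH abs_le_of_decay510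
  solvesKKT_Gam tempered_Gam tempered_GamΦ tempered_GamM eq_Gam_of_solvesKKT eq_wH_of_solvesKKT)
open DecimatedMomentLimit (summable_of_decay510)
open OneStepResolventKernel (Fib KInv KInv_inl_inl KInv_inr_inl_coarse)
open B12Sec2to5 (l1 l1_nonneg Decay510 summable_exp_neg_l1)

open ResolventComposition

variable {D N : ℕ}

/-! ## §9 Step (B) (v5): the abstract two-level decomposition and the composite of (K1aᵀ)

`decomposition_of_EL` abstracts `GcolSum_decomposition` (§7) from covariance fields of finite co-closed combinations to ANY
bounded field `U` with summable components whose Euler–Lagrange identity at level `N′ = ML` has NO gauge term,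
`d*d U = 𝒬ᵀ_{N′} Φ + a` with bounded `Φ`, `a`, and whose `δdδ U` is `N′`-block-constant: then
`U(κ₀, x₀) = ⟨Γ_M(·; κ₀, x₀), a⟩ + Σ_{(l″, w′)} (𝒬_M U)(l″, w′) ℋ_M(κ₀, x₀; l″, w′)`.  This is the form in which (A)
applies to the INFINITE-support co-closed force `𝒬_Mᵀ ℋ_Mᵀ F′` of step (B).  Plan of the section: §9.1 the decomposition
and the kernel `GQ = (𝒬_M ⊗ 𝒬_M) Γ_{N′}`; §9.2 linear operations through finite and
absolutely convergent combinations; §9.3 superpositions `Σ′_w Σ_j c_j(w) X_j(w)` with `ℓ¹` coefficients and uniformly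
bounded columns — (EL), (G), zero block means, and `gaugeMult_eq_zero` (no gauge term when the force is co-closed);
§9.4 the field `V_ζ = Γ_{N′} 𝒬_Mᵀ ζ` and its pure-minimiser decomposition; §9.5 the two pairings and
`pairing_identity`; §9.6 the composite `compA_apply` (the `(inl, inl)` entry of `KInv_M ∘ ι(KInvStep) ∘ KInv_M` is
`−PQ`, a double superposition of level-`M` minimisers with kernel `GQ`), `k1aTrans`, `k1_trio`. -/

section StepB

open ExpKernelCalculus (comp)
open OneStepKernelFamily (KInvStep dec legSet legW legPt LegIdx)
open InterLevelTransport (liftW slotW slotW_true slotW_false liftW_zsmul liftW_off liftW_inl_left liftW_inl_right)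
open StepDriftWitness (sum_LegIdx_eq_contourSum)
open OneStepResolventKernel (KInv_inl_inr_coarse)
open KKTFluctuationEnergy (GcolSum Gam_symm)

variable {d : ℕ}

/-- **THE ABSTRACT TWO-LEVEL DECOMPOSITION.**  `N′ = ML`; `U` bounded with summable components, `d*d U = 𝒬ᵀ_{N′}Φ + a`
(no gauge term) with `Φ`, `a` bounded, `δdδ U` block-constant for `N′`.  Then
`U(κ₀, x₀) = ⟨Γ_M(·; κ₀, x₀), a⟩ + Σ'_{w′} Σ_{l″} (𝒬_M U)(l″, w′) · wH_M κ₀ l″ (x₀ − M•w′)` — the proof of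
`GcolSum_decomposition` verbatim with the force left abstract. [folklore] -/
theorem decomposition_of_EL {N' M L : ℕ} [NeZero N'] [NeZero M] [NeZero L] (hN : N' = M * L)
    {U a : Form1 (d + 1) ℝ} {Φ : Form1 (d + 1) ℝ} {K : ℝ}
    (hUb : ∀ μ x, |U μ x| ≤ K) (hUs : ∀ μ, Summable (U μ)) (hΦUb : ∀ κ y, |Φ κ y| ≤ K) (hab : ∀ μ x, |a μ x| ≤ K)
    (hELU : curvAdj (curv U) = contourSumAdj N' Φ + a) (hGU : IsBlockConst N' (codiff₁ (dz (codiff₁ U))))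
    (κ₀ : Fin (d + 1)) (x₀ : AffineAveraging.Site (d + 1)) :
    U κ₀ x₀ = lip1 (Gcol (N := M) κ₀ x₀) a + ∑' w' : (Fin (d + 1) → ℤ), ∑ l'' : Fin (d + 1),
          contourSum M U l'' w' * wH (N := M) (d := d) κ₀ l'' (x₀ - (M : ℤ) • w') := by
  subst hN
  obtain ⟨C, _, hbdd, hsum⟩ := Gcol_bdd_summable (N := M) (d := d)
  obtain ⟨CM, _, hMb, hMs⟩ := Mcol_bdd_summable (N := M) (d := d)
  obtain ⟨CΦ, _, hΦ⟩ := Φcol_bdd (N := M) (d := d)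
  have hM : 0 < M := Nat.pos_of_ne_zero (NeZero.ne M)
  have sQ : ∀ μ', Summable (fun x => Gcol (N := M) κ₀ x₀ μ' x * contourSumAdj (M * L) Φ μ' x) :=
    fun μ' => summable_mul_of_bdd' (hsum κ₀ x₀ μ') (fun x => abs_contourSumAdj_le hΦUb μ' x)
  have sδ : ∀ μ', Summable (fun x => Gcol (N := M) κ₀ x₀ μ' x * a μ' x) :=
    fun μ' => summable_mul_of_bdd' (hsum κ₀ x₀ μ') (hab μ')
  have hP0 : lip1 U (curvAdj (curv (Gcol (N := M) κ₀ x₀))) = lip1 (Gcol (N := M) κ₀ x₀) a := by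
    rw [lip1_curvAdj hUb (fun κ l => summable_curv (hsum κ₀ x₀) κ l), lip2_comm,
      ← lip1_curvAdj (hbdd κ₀ x₀) (fun κ l => summable_curv hUs κ l), hELU, lip1_add sQ sδ,
      lip1_contourSumAdj (N := M * L) (hsum κ₀ x₀) hΦUb]
    have hz : ∑' y, ∑ κ, Φ κ y * contourSum (M * L) (Gcol (N := M) κ₀ x₀) κ y = 0 := by
      refine (tsum_congr fun y => ?_).trans tsum_zero
      refine Finset.sum_eq_zero fun κ _ => ?_
      have h0 : contourSum M (Gcol (N := M) κ₀ x₀) = 0 := by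
        funext κ' y'
        exact Gam_Q (N := M) κ₀ x₀ κ' y'
      have hQ : contourSum (M * L) (Gcol (N := M) κ₀ x₀) κ y = 0 := by
        rw [contourSum_mul M L hM, h0]
        simp [contourSum]
      rw [hQ, mul_zero]
    rw [hz, zero_add]
  have h1 : lip1 U (contourSumAdj M (Φcol (N := M) κ₀ x₀))
      = -∑' w' : (Fin (d + 1) → ℤ), ∑ l'' : Fin (d + 1),
          contourSum M U l'' w' * wH (N := M) (d := d) κ₀ l'' (x₀ - (M : ℤ) • w') := by
    rw [lip1_contourSumAdj (N := M) hUs (hΦ κ₀ x₀), ← tsum_neg]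
    refine tsum_congr fun w' => ?_
    rw [← Finset.sum_neg_distrib]
    refine Finset.sum_congr rfl fun l'' _ => ?_
    rw [show Φcol (N := M) κ₀ x₀ l'' w' = GamΦ (N := M) l'' w' κ₀ x₀ from rfl, GamΦ_eq_neg_wH]
    ring
  have h2 : lip1 U (dz (codiff₁ (dz (Mcol (N := M) κ₀ x₀)))) = 0 := by
    have hK : 0 ≤ K := le_trans (abs_nonneg _) (hUb κ₀ x₀)
    have e1 : ∀ x, |codiff₁ U x| ≤ (d + 1 : ℕ) * (2 * K) := fun x => abs_codiff₁_le hUb x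
    have e2 : ∀ κ x, |dz (codiff₁ U) κ x| ≤ 2 * ((d + 1 : ℕ) * (2 * K)) := fun κ x => abs_dz_le e1 κ x
    have e3 : ∀ x, |codiff₁ (dz (codiff₁ U)) x| ≤ (d + 1 : ℕ) * (2 * (2 * ((d + 1 : ℕ) * (2 * K)))) :=
      fun x => abs_codiff₁_le e2 x
    have hdzM : ∀ κ, Summable (dz (Mcol (N := M) κ₀ x₀) κ) := fun κ => summable_dz (hMs κ₀ x₀) κ
    rw [lip1_dz hUb (summable_codiff₁ hdzM), lip0_codiff₁ e1 hdzM, lip1_dz e2 (hMs κ₀ x₀)]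
    exact tsum_mul_eq_zero_of_blockConst (N := M) e3 (isBlockConst_of_mul hGU) (hMs κ₀ x₀) (GamM_M (N := M) κ₀ x₀)
  have h3 : lip1 U (δcol κ₀ x₀) = U κ₀ x₀ := by
    unfold lip1
    have e : ∀ x, ∑ μ' : Fin (d + 1), U μ' x * δcol κ₀ x₀ μ' x = if x = x₀ then U κ₀ x₀ else 0 := by
      intro x
      by_cases hx : x = x₀
      · subst hx
        simp [δcol]
      · simp [δcol, hx]
    rw [tsum_congr e, tsum_eq_single x₀ (fun x hx => if_neg hx), if_pos rfl]
  have sT1 : ∀ μ', Summable (fun x => U μ' x * contourSumAdj M (Φcol (N := M) κ₀ x₀) μ' x) :=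
    fun μ' => summable_mul_of_bdd' (hUs μ') (fun x => abs_contourSumAdj_le (hΦ κ₀ x₀) μ' x)
  have hT2b : ∀ μ' x, |dz (codiff₁ (dz (Mcol (N := M) κ₀ x₀))) μ' x| ≤ 2 * ((d + 1 : ℕ) * (2 * (2 * CM))) := fun μ' x =>
    abs_dz_le (fun z => abs_codiff₁_le (fun κ w => abs_dz_le (hMb κ₀ x₀) κ w) z) μ' x
  have sT2 : ∀ μ', Summable (fun x => U μ' x * dz (codiff₁ (dz (Mcol (N := M) κ₀ x₀))) μ' x) :=
    fun μ' => summable_mul_of_bdd' (hUs μ') (hT2b μ')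
  have sδ' : ∀ μ', Summable (fun x => U μ' x * δcol κ₀ x₀ μ' x) := fun μ' =>
    summable_mul_of_bdd' (M := 1) (hUs μ') (fun x => by
      unfold δcol
      split_ifs <;> simp)
  have s12 : ∀ μ', Summable (fun x => U μ' x
      * (contourSumAdj M (Φcol (N := M) κ₀ x₀) + dz (codiff₁ (dz (Mcol (N := M) κ₀ x₀)))) μ' x) := fun μ' => by
    have h := (sT1 μ').add (sT2 μ')
    simpa only [Pi.add_apply, mul_add] using h
  have hP : lip1 U (curvAdj (curv (Gcol (N := M) κ₀ x₀)))
      = -(∑' w' : (Fin (d + 1) → ℤ), ∑ l'' : Fin (d + 1),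
          contourSum M U l'' w' * wH (N := M) (d := d) κ₀ l'' (x₀ - (M : ℤ) • w')) + 0 + U κ₀ x₀ := by
    rw [curvAdj_curv_Gcol, lip1_add s12 sδ', lip1_add sT1 sT2, h1, h2, h3]
  rw [hP0] at hP
  linarith

/-- The (field, field) entries of a decimated kernel: BOTH legs are `M`-block-contour averages. [folklore] -/
theorem dec_inl_inl (M : ℕ) (K : ExpKernelCalculus.MKer (d + 1) (Fib d)) (κ l : Fin (d + 1)) (x' y' : Fin (d + 1) → ℤ) :
    dec M K x' y' (Sum.inl κ) (Sum.inl l)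
      = ∑ i ∈ LegIdx d M, ∑ i' ∈ LegIdx d M, ((M : ℝ) ^ (d + 2))⁻¹ * ((M : ℝ) ^ (d + 2))⁻¹
          * K (legPt M (Sum.inl κ) x' i) (legPt M (Sum.inl l) y' i') (Sum.inl κ) (Sum.inl l) := rfl

/-- **THE DOUBLE BLOCK-CONTOUR SUM OF THE COVARIANCE** `𝒬_M Γ_N 𝒬_Mᵀ` (unnormalised): `GQ M μ z′ ν w′ :=
Σ_{p ∈ contour(μ, z′)} Σ_{q ∈ contour(ν, w′)} Γ_N((μ, p), (ν, q))`. [folklore] -/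
def GQ [NeZero N] (M : ℕ) (μ : Fin (d + 1)) (z' : AffineAveraging.Site (d + 1)) (ν : Fin (d + 1))
    (w' : AffineAveraging.Site (d + 1)) : ℝ :=
  contourSum M (fun μ' p => contourSum M (Gcol (N := N) μ' p) ν w') μ z'

/-! ### §9.2 Linear operations through finite combinations and through absolutely convergent series

Generic bookkeeping (any dimension `D`, any index type): `∂`, `δ₁`, `d`, `d*`, `𝒬ᵀ` and block sums commute with
finite linear combinations and — under pointwise absolute convergence — with `∑'`. -/

section LinOps

open KernelSpecInstance (curv_add curv_smul curvAdj_add curvAdj_smul codiff₁_smul dz_smul contourSumAdj_add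
  contourSumAdj_smul)
open AffineReproduction (dz_add)

variable {D : ℕ} {ι : Type*}

/-- `∂ (Σ cᵢ Xᵢ) = Σ cᵢ ∂Xᵢ`. [folklore] -/
theorem dz_finsum_mul (s : Finset ι) (c : ι → ℝ) (X : ι → Form0 D ℝ) :
    dz (fun x => ∑ i ∈ s, c i * X i x) = fun κ x => ∑ i ∈ s, c i * dz (X i) κ x := by
  classical
  induction s using Finset.induction_on with
  | empty => funext κ x; simp [dz]
  | @insert b s hb ih =>
    have e : (fun x => ∑ i ∈ insert b s, c i * X i x) = c b • X b + fun x => ∑ i ∈ s, c i * X i x := by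
      funext x; simp [Finset.sum_insert hb]
    rw [e, dz_add, dz_smul, ih]
    funext κ x; simp [Finset.sum_insert hb]

/-- `δ₁ (Σ cᵢ Xᵢ) = Σ cᵢ δ₁Xᵢ`. [folklore] -/
theorem codiff₁_finsum_mul (s : Finset ι) (c : ι → ℝ) (X : ι → Form1 D ℝ) :
    codiff₁ (fun κ x => ∑ i ∈ s, c i * X i κ x) = fun x => ∑ i ∈ s, c i * codiff₁ (X i) x := by
  classical
  induction s using Finset.induction_on with
  | empty => funext x; simp [codiff₁]
  | @insert b s hb ih =>
    have e : (fun κ x => ∑ i ∈ insert b s, c i * X i κ x) = c b • X b + fun κ x => ∑ i ∈ s, c i * X i κ x := by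
      funext κ x; simp [Finset.sum_insert hb]
    rw [e, codiff₁_add, codiff₁_smul, ih]
    funext x; simp [Finset.sum_insert hb]

/-- `d (Σ cᵢ Xᵢ) = Σ cᵢ dXᵢ`. [folklore] -/
theorem curv_finsum_mul (s : Finset ι) (c : ι → ℝ) (X : ι → Form1 D ℝ) :
    curv (fun κ x => ∑ i ∈ s, c i * X i κ x) = fun κ l x => ∑ i ∈ s, c i * curv (X i) κ l x := by
  classical
  induction s using Finset.induction_on with
  | empty => funext κ l x; simp [curv]
  | @insert b s hb ih =>
    have e : (fun κ x => ∑ i ∈ insert b s, c i * X i κ x) = c b • X b + fun κ x => ∑ i ∈ s, c i * X i κ x := by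
      funext κ x; simp [Finset.sum_insert hb]
    rw [e, curv_add, curv_smul, ih]
    funext κ l x; simp [Finset.sum_insert hb]

/-- `d* (Σ cᵢ Fᵢ) = Σ cᵢ d*Fᵢ`. [folklore] -/
theorem curvAdj_finsum_mul (s : Finset ι) (c : ι → ℝ) (X : ι → Form2 D ℝ) :
    curvAdj (fun κ l x => ∑ i ∈ s, c i * X i κ l x) = fun μ y => ∑ i ∈ s, c i * curvAdj (X i) μ y := by
  classical
  induction s using Finset.induction_on with
  | empty => funext μ y; simp [curvAdj]
  | @insert b s hb ih =>
    have e : (fun κ l x => ∑ i ∈ insert b s, c i * X i κ l x)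
        = c b • X b + fun κ l x => ∑ i ∈ s, c i * X i κ l x := by
      funext κ l x; simp [Finset.sum_insert hb]
    rw [e, curvAdj_add, curvAdj_smul, ih]
    funext μ y; simp [Finset.sum_insert hb]

/-- `𝒬ᵀ (Σ cᵢ φᵢ) = Σ cᵢ 𝒬ᵀφᵢ`. [folklore] -/
theorem contourSumAdj_finsum_mul (L : ℕ) (s : Finset ι) (c : ι → ℝ) (X : ι → Form1 D ℝ) :
    contourSumAdj L (fun κ q => ∑ i ∈ s, c i * X i κ q) = fun κ x => ∑ i ∈ s, c i * contourSumAdj L (X i) κ x := by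
  classical
  induction s using Finset.induction_on with
  | empty => funext κ x; simp [contourSumAdj_eq]
  | @insert b s hb ih =>
    have e : (fun κ q => ∑ i ∈ insert b s, c i * X i κ q) = c b • X b + fun κ q => ∑ i ∈ s, c i * X i κ q := by
      funext κ q; simp [Finset.sum_insert hb]
    rw [e, contourSumAdj_add, contourSumAdj_smul, ih]
    funext κ x; simp [Finset.sum_insert hb]

/-- `blockSum (Σ cᵢ Yᵢ) = Σ cᵢ blockSum Yᵢ`. [folklore] -/
theorem blockSum_finsum_mul (L : ℕ) (s : Finset ι) (c : ι → ℝ) (Y : ι → Form0 D ℝ) (y : AffineAveraging.Site D) :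
    blockSum L (fun z => ∑ i ∈ s, c i * Y i z) y = ∑ i ∈ s, c i * blockSum L (Y i) y := by
  simp only [blockSum, Finset.mul_sum]
  exact Finset.sum_comm

/-- `∂` through a pointwise absolutely convergent series. [folklore] -/
theorem dz_tsum {f : ι → Form0 D ℝ} (hf : ∀ x, Summable fun i => f i x) :
    dz (fun x => ∑' i, f i x) = fun κ x => ∑' i, dz (f i) κ x := by
  funext κ x
  simp only [dz]
  exact ((hf _).tsum_sub (hf _)).symm

/-- `δ₁` through a pointwise absolutely convergent series. [folklore] -/
theorem codiff₁_tsum {f : ι → Form1 D ℝ} (hf : ∀ κ x, Summable fun i => f i κ x) :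
    codiff₁ (fun κ x => ∑' i, f i κ x) = fun x => ∑' i, codiff₁ (f i) x := by
  funext x
  simp only [codiff₁]
  rw [Summable.tsum_finsetSum (fun κ _ => (hf κ _).sub (hf κ _))]
  exact Finset.sum_congr rfl fun κ _ => ((hf κ _).tsum_sub (hf κ _)).symm

/-- `d` through a pointwise absolutely convergent series. [folklore] -/
theorem curv_tsum {f : ι → Form1 D ℝ} (hf : ∀ κ x, Summable fun i => f i κ x) :
    curv (fun κ x => ∑' i, f i κ x) = fun κ l x => ∑' i, curv (f i) κ l x := by
  funext κ l x
  simp only [curv]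
  rw [(((hf κ x).add (hf l _)).sub (hf κ _)).tsum_sub (hf l x), ((hf κ x).add (hf l _)).tsum_sub (hf κ _),
    (hf κ x).tsum_add (hf l _)]

/-- `d*` through a pointwise absolutely convergent series. [folklore] -/
theorem curvAdj_tsum {f : ι → Form2 D ℝ} (hf : ∀ κ l x, Summable fun i => f i κ l x) :
    curvAdj (fun κ l x => ∑' i, f i κ l x) = fun μ y => ∑' i, curvAdj (f i) μ y := by
  funext μ y
  simp only [curvAdj]
  have hA : ∀ l, Summable fun i => f i μ l y - f i μ l (y - unitVec l) := fun l => (hf μ l y).sub (hf μ l _)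
  have hB : ∀ κ, Summable fun i => f i κ μ (y - unitVec κ) - f i κ μ y := fun κ => (hf κ μ _).sub (hf κ μ y)
  rw [(summable_sum fun l _ => hA l).tsum_add (summable_sum fun κ _ => hB κ),
    Summable.tsum_finsetSum (fun l _ => hA l), Summable.tsum_finsetSum (fun κ _ => hB κ)]
  congr 1
  · exact Finset.sum_congr rfl fun l _ => ((hf μ l y).tsum_sub (hf μ l _)).symm
  · exact Finset.sum_congr rfl fun κ _ => ((hf κ μ _).tsum_sub (hf κ μ y)).symm

/-- `𝒬ᵀ` through a pointwise absolutely convergent series. [folklore] -/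
theorem contourSumAdj_tsum (L : ℕ) {f : ι → Form1 D ℝ} (hf : ∀ κ q, Summable fun i => f i κ q) :
    contourSumAdj L (fun κ q => ∑' i, f i κ q) = fun κ x => ∑' i, contourSumAdj L (f i) κ x := by
  funext κ x
  simp only [contourSumAdj_eq]
  exact (Summable.tsum_finsetSum fun s _ => hf κ _).symm

/-- Block sums through a pointwise absolutely convergent series. [folklore] -/
theorem blockSum_tsum (L : ℕ) {f : ι → Form0 D ℝ} (hf : ∀ x, Summable fun i => f i x) (y : AffineAveraging.Site D) :
    blockSum L (fun x => ∑' i, f i x) y = ∑' i, blockSum L (f i) y := by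
  simp only [blockSum]
  exact (Summable.tsum_finsetSum fun b _ => hf _).symm

/-- Fubini bookkeeping: a family of rows, each summable, with summable `ℓ¹` row masses is jointly summable. [folklore] -/
theorem summable_uncurry_of_tsum_abs_le {f : AffineAveraging.Site D → AffineAveraging.Site D → ℝ}
    {B : AffineAveraging.Site D → ℝ} (hfy : ∀ y, Summable (f y)) (hB : ∀ y, ∑' x, |f y x| ≤ B y) (hBs : Summable B) :
    Summable (Function.uncurry f) := by
  have hG : Summable (fun p : AffineAveraging.Site D × AffineAveraging.Site D => |f p.1 p.2|) := by
    refine (summable_prod_of_nonneg (fun p => abs_nonneg _)).mpr ⟨fun y => (hfy y).abs, ?_⟩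
    exact Summable.of_nonneg_of_le (fun y => tsum_nonneg fun x => abs_nonneg _) hB hBs
  exact summable_abs_iff.mp hG

/-- A uniform `ℓ¹` bound from exponential decay about a centre: `Σ_x |f x| ≤ C · Σ_v e^{−δ|v|₁}`. [folklore] -/
theorem tsum_abs_le_of_exp_bound {f : AffineAveraging.Site D → ℝ} {C δ : ℝ} (hδ : 0 < δ) (c : AffineAveraging.Site D)
    (h : ∀ x, |f x| ≤ C * Real.exp (-δ * l1 (x - c))) :
    ∑' x, |f x| ≤ C * ∑' v : AffineAveraging.Site D, Real.exp (-δ * l1 v) := by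
  have hs : Summable fun x : AffineAveraging.Site D => Real.exp (-δ * l1 (x - c)) :=
    summable_shift_sub (summable_exp_neg_l1 hδ D) c
  have h1 : ∑' x, |f x| ≤ ∑' x, C * Real.exp (-δ * l1 (x - c)) :=
    Summable.tsum_le_tsum h (summable_of_exp_bound hδ c h).abs (hs.mul_left C)
  have h2 : ∑' x : AffineAveraging.Site D, Real.exp (-δ * l1 (x - c))
      = ∑' v : AffineAveraging.Site D, Real.exp (-δ * l1 v) := by
    rw [← (Equiv.subRight c).tsum_eq (fun v : AffineAveraging.Site D => Real.exp (-δ * l1 v))]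
    exact tsum_congr fun x => by simp [Equiv.subRight]
  rw [tsum_mul_left, h2] at h1
  exact h1

end LinOps

/-! ### §9.3 Absolutely convergent two-level superpositions of columns

`sup1 J c X = Σ'_w Σ_{j ∈ J} c_j(w) X_j(w)`: an outer absolutely convergent sum over coarse sites `w` of finite
combinations.  If every column `X_j(w)` satisfies (EL) with data `(Φ_j(w), m_j(w), f_j(w))`, (G) and (M), with
UNIFORM sup bounds and uniform `ℓ¹` column bounds, then so does the superposition, with the superposed data. -/

section Superposition

variable {D : ℕ} {β : Type*}

/-- The `ℓ¹` mass `Σ'_w Σ_{j ∈ J} |c_j(w)|`. [folklore] -/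
def l1n (J : Finset β) (c : β → AffineAveraging.Site D → ℝ) : ℝ := ∑' w, ∑ j ∈ J, |c j w|

/-- Two-level superposition of 1-forms. [folklore] -/
def sup1 (J : Finset β) (c : β → AffineAveraging.Site D → ℝ) (X : β → AffineAveraging.Site D → Form1 D ℝ) : Form1 D ℝ :=
  fun κ x => ∑' w, ∑ j ∈ J, c j w * X j w κ x

/-- Two-level superposition of 0-forms. [folklore] -/
def sup0 (J : Finset β) (c : β → AffineAveraging.Site D → ℝ) (Y : β → AffineAveraging.Site D → Form0 D ℝ) : Form0 D ℝ :=
  fun z => ∑' w, ∑ j ∈ J, c j w * Y j w z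

/-- `0 ≤ ‖c‖₁`. [folklore] -/
theorem l1n_nonneg (J : Finset β) (c : β → AffineAveraging.Site D → ℝ) : 0 ≤ l1n J c :=
  tsum_nonneg fun _ => Finset.sum_nonneg fun _ _ => abs_nonneg _

/-- Summability of the row masses. [folklore] -/
theorem summable_finsum_abs (J : Finset β) {c : β → AffineAveraging.Site D → ℝ} (hc : ∀ j, Summable (c j)) :
    Summable fun w => ∑ j ∈ J, |c j w| :=
  summable_sum fun j _ => (hc j).abs

/-- Summability of `w ↦ Σ_j c_j(w) Y_j(w)` for bounded `Y`. [folklore] -/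
theorem summable_finsum_mul (J : Finset β) {c : β → AffineAveraging.Site D → ℝ} (hc : ∀ j, Summable (c j))
    {Y : β → AffineAveraging.Site D → ℝ} {C : ℝ} (hY : ∀ j w, |Y j w| ≤ C) :
    Summable fun w => ∑ j ∈ J, c j w * Y j w :=
  summable_sum fun j _ => summable_mul_of_bdd' (hc j) (hY j)

/-- `|Σ'_w Σ_j c_j(w) Y_j(w)| ≤ C ‖c‖₁` for `|Y| ≤ C`. [folklore] -/
theorem abs_tsum_finsum_mul_le (J : Finset β) {c : β → AffineAveraging.Site D → ℝ} (hc : ∀ j, Summable (c j))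
    {Y : β → AffineAveraging.Site D → ℝ} {C : ℝ} (hY : ∀ j w, |Y j w| ≤ C) :
    |∑' w, ∑ j ∈ J, c j w * Y j w| ≤ C * l1n J c := by
  have hs := summable_finsum_mul J hc hY
  have h1 : |∑' w, ∑ j ∈ J, c j w * Y j w| ≤ ∑' w, |∑ j ∈ J, c j w * Y j w| := by
    have h := norm_tsum_le_tsum_norm (f := fun w => ∑ j ∈ J, c j w * Y j w)
      (by simpa only [Real.norm_eq_abs] using hs.abs)
    simpa only [Real.norm_eq_abs] using h
  have h2 : ∑' w, |∑ j ∈ J, c j w * Y j w| ≤ ∑' w, C * ∑ j ∈ J, |c j w| := by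
    refine Summable.tsum_le_tsum (fun w => ?_) hs.abs ((summable_finsum_abs J hc).mul_left C)
    rw [Finset.mul_sum]
    refine (Finset.abs_sum_le_sum_abs _ _).trans (Finset.sum_le_sum fun j _ => ?_)
    rw [abs_mul, mul_comm]
    exact mul_le_mul_of_nonneg_right (hY j w) (abs_nonneg _)
  rw [tsum_mul_left] at h2
  exact h1.trans h2

/-- Joint summability of `(w, x) ↦ Σ_j c_j(w) X_j(w)(x)` from uniform `ℓ¹` column bounds. [folklore] -/
theorem summable_uncurry_sup (J : Finset β) {c : β → AffineAveraging.Site D → ℝ} (hc : ∀ j, Summable (c j))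
    {X : β → AffineAveraging.Site D → AffineAveraging.Site D → ℝ} {C₁ : ℝ} (hXs : ∀ j w, Summable (X j w))
    (hX1 : ∀ j w, ∑' x, |X j w x| ≤ C₁) :
    Summable (Function.uncurry fun w x => ∑ j ∈ J, c j w * X j w x) := by
  refine summable_uncurry_of_tsum_abs_le (B := fun w => (∑ j ∈ J, |c j w|) * C₁)
    (fun w => summable_sum fun j _ => (hXs j w).mul_left (c j w)) (fun w => ?_)
    ((summable_finsum_abs J hc).mul_right C₁)
  have hs : Summable fun x => ∑ j ∈ J, c j w * X j w x := summable_sum fun j _ => (hXs j w).mul_left (c j w)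
  have hs' : ∀ j ∈ J, Summable fun x => |c j w| * |X j w x| := fun j _ => (hXs j w).abs.mul_left |c j w|
  calc ∑' x, |∑ j ∈ J, c j w * X j w x| ≤ ∑' x, ∑ j ∈ J, |c j w| * |X j w x| :=
        Summable.tsum_le_tsum (fun x => (Finset.abs_sum_le_sum_abs _ _).trans
          (le_of_eq (Finset.sum_congr rfl fun j _ => abs_mul _ _))) hs.abs (summable_sum hs')
    _ = ∑ j ∈ J, |c j w| * ∑' x, |X j w x| := by
        rw [Summable.tsum_finsetSum hs']
        exact Finset.sum_congr rfl fun j _ => tsum_mul_left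
    _ ≤ ∑ j ∈ J, |c j w| * C₁ := Finset.sum_le_sum fun j _ => mul_le_mul_of_nonneg_left (hX1 j w) (abs_nonneg _)
    _ = (∑ j ∈ J, |c j w|) * C₁ := by rw [Finset.sum_mul]

/-- Sup bound of a superposition of uniformly bounded 1-forms. [folklore] -/
theorem abs_sup1_le (J : Finset β) {c : β → AffineAveraging.Site D → ℝ} (hc : ∀ j, Summable (c j))
    {X : β → AffineAveraging.Site D → Form1 D ℝ} {C : ℝ} (hX : ∀ j w κ x, |X j w κ x| ≤ C) (κ : Fin D)
    (x : AffineAveraging.Site D) : |sup1 J c X κ x| ≤ C * l1n J c :=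
  abs_tsum_finsum_mul_le J hc (fun j w => hX j w κ x)

/-- Sup bound of a superposition of uniformly bounded 0-forms. [folklore] -/
theorem abs_sup0_le (J : Finset β) {c : β → AffineAveraging.Site D → ℝ} (hc : ∀ j, Summable (c j))
    {Y : β → AffineAveraging.Site D → Form0 D ℝ} {C : ℝ} (hY : ∀ j w z, |Y j w z| ≤ C) (z : AffineAveraging.Site D) :
    |sup0 J c Y z| ≤ C * l1n J c :=
  abs_tsum_finsum_mul_le J hc (fun j w => hY j w z)

/-- Summable components of a superposition of uniformly `ℓ¹` 1-forms. [folklore] -/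
theorem summable_sup1 (J : Finset β) {c : β → AffineAveraging.Site D → ℝ} (hc : ∀ j, Summable (c j))
    {X : β → AffineAveraging.Site D → Form1 D ℝ} {C₁ : ℝ} (hXs : ∀ j w κ, Summable (X j w κ))
    (hX1 : ∀ j w κ, ∑' x, |X j w κ x| ≤ C₁) (κ : Fin D) : Summable (sup1 J c X κ) :=
  ((summable_uncurry_sup J hc (fun j w => hXs j w κ) (fun j w => hX1 j w κ)).prod_symm.prod).congr fun _ => rfl

/-- Summability of a superposition of uniformly `ℓ¹` 0-forms. [folklore] -/
theorem summable_sup0 (J : Finset β) {c : β → AffineAveraging.Site D → ℝ} (hc : ∀ j, Summable (c j))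
    {Y : β → AffineAveraging.Site D → Form0 D ℝ} {C₁ : ℝ} (hYs : ∀ j w, Summable (Y j w))
    (hY1 : ∀ j w, ∑' z, |Y j w z| ≤ C₁) : Summable (sup0 J c Y) :=
  ((summable_uncurry_sup J hc hYs hY1).prod_symm.prod).congr fun _ => rfl

/-- **(EL) OF A SUPERPOSITION**: columnwise `d*d X = 𝒬ᵀΦ + ∂δ₁∂ m + f` with uniform bounds sums to
`d*d (Σ c X) = 𝒬ᵀ(Σ c Φ) + ∂δ₁∂ (Σ c m) + Σ c f`. [folklore] -/
theorem curvAdj_curv_sup1 {N : ℕ} (J : Finset β) {c : β → AffineAveraging.Site D → ℝ} (hc : ∀ j, Summable (c j))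
    {X Φc fc : β → AffineAveraging.Site D → Form1 D ℝ} {Mc : β → AffineAveraging.Site D → Form0 D ℝ} {C : ℝ}
    (hX : ∀ j w κ x, |X j w κ x| ≤ C) (hΦ : ∀ j w κ q, |Φc j w κ q| ≤ C) (hM : ∀ j w z, |Mc j w z| ≤ C)
    (hf : ∀ j w κ x, |fc j w κ x| ≤ C)
    (hEL : ∀ j w, curvAdj (curv (X j w)) = contourSumAdj N (Φc j w) + dz (codiff₁ (dz (Mc j w))) + fc j w) :
    curvAdj (curv (sup1 J c X))
      = contourSumAdj N (sup1 J c Φc) + dz (codiff₁ (dz (sup0 J c Mc))) + sup1 J c fc := by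
  have sX : ∀ κ x, Summable fun w => ∑ j ∈ J, c j w * X j w κ x :=
    fun κ x => summable_finsum_mul J hc fun j w => hX j w κ x
  have scurv : ∀ κ l x, Summable fun w => ∑ j ∈ J, c j w * curv (X j w) κ l x :=
    fun κ l x => summable_finsum_mul J hc fun j w => abs_curv_le (hX j w) κ l x
  have sΦ : ∀ κ q, Summable fun w => ∑ j ∈ J, c j w * Φc j w κ q :=
    fun κ q => summable_finsum_mul J hc fun j w => hΦ j w κ q
  have scsa : ∀ μ z, Summable fun w => ∑ j ∈ J, c j w * contourSumAdj N (Φc j w) μ z :=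
    fun μ z => summable_finsum_mul J hc fun j w => abs_contourSumAdj_le (hΦ j w) μ z
  have sM : ∀ z, Summable fun w => ∑ j ∈ J, c j w * Mc j w z := fun z => summable_finsum_mul J hc fun j w => hM j w z
  have sdM : ∀ κ z, Summable fun w => ∑ j ∈ J, c j w * dz (Mc j w) κ z :=
    fun κ z => summable_finsum_mul J hc fun j w => abs_dz_le (hM j w) κ z
  have scdM : ∀ z, Summable fun w => ∑ j ∈ J, c j w * codiff₁ (dz (Mc j w)) z :=
    fun z => summable_finsum_mul J hc fun j w => abs_codiff₁_le (fun κ z => abs_dz_le (hM j w) κ z) z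
  have sdcdM : ∀ κ z, Summable fun w => ∑ j ∈ J, c j w * dz (codiff₁ (dz (Mc j w))) κ z :=
    fun κ z => summable_finsum_mul J hc fun j w =>
      abs_dz_le (fun z => abs_codiff₁_le (fun κ z => abs_dz_le (hM j w) κ z) z) κ z
  have sf : ∀ κ x, Summable fun w => ∑ j ∈ J, c j w * fc j w κ x :=
    fun κ x => summable_finsum_mul J hc fun j w => hf j w κ x
  -- the left-hand side
  have h1 : curv (sup1 J c X) = fun κ l x => ∑' w, ∑ j ∈ J, c j w * curv (X j w) κ l x := by
    rw [show sup1 J c X = fun κ x => ∑' w, (fun w κ x => ∑ j ∈ J, c j w * X j w κ x) w κ x from rfl,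
      curv_tsum (f := fun w κ x => ∑ j ∈ J, c j w * X j w κ x) sX]
    funext κ l x
    exact tsum_congr fun w => by rw [curv_finsum_mul]
  have h2 : curvAdj (curv (sup1 J c X)) = fun μ z => ∑' w, ∑ j ∈ J, c j w * curvAdj (curv (X j w)) μ z := by
    rw [h1, curvAdj_tsum (f := fun w κ l x => ∑ j ∈ J, c j w * curv (X j w) κ l x) scurv]
    funext μ z
    exact tsum_congr fun w => by rw [curvAdj_finsum_mul]
  have h3 : ∀ w μ z, ∑ j ∈ J, c j w * curvAdj (curv (X j w)) μ z
      = ∑ j ∈ J, c j w * contourSumAdj N (Φc j w) μ z + ∑ j ∈ J, c j w * dz (codiff₁ (dz (Mc j w))) μ z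
        + ∑ j ∈ J, c j w * fc j w μ z := by
    intro w μ z
    rw [← Finset.sum_add_distrib, ← Finset.sum_add_distrib]
    refine Finset.sum_congr rfl fun j _ => ?_
    rw [hEL j w]
    simp only [Pi.add_apply]
    ring
  -- the right-hand side
  have r1 : contourSumAdj N (sup1 J c Φc) = fun μ z => ∑' w, ∑ j ∈ J, c j w * contourSumAdj N (Φc j w) μ z := by
    rw [show sup1 J c Φc = fun κ q => ∑' w, (fun w κ q => ∑ j ∈ J, c j w * Φc j w κ q) w κ q from rfl,
      contourSumAdj_tsum (f := fun w κ q => ∑ j ∈ J, c j w * Φc j w κ q) N sΦ]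
    funext μ z
    exact tsum_congr fun w => by rw [contourSumAdj_finsum_mul]
  have r2a : dz (sup0 J c Mc) = fun κ z => ∑' w, ∑ j ∈ J, c j w * dz (Mc j w) κ z := by
    rw [show sup0 J c Mc = fun z => ∑' w, (fun w z => ∑ j ∈ J, c j w * Mc j w z) w z from rfl,
      dz_tsum (f := fun w z => ∑ j ∈ J, c j w * Mc j w z) sM]
    funext κ z
    exact tsum_congr fun w => by rw [dz_finsum_mul]
  have r2b : codiff₁ (dz (sup0 J c Mc)) = fun z => ∑' w, ∑ j ∈ J, c j w * codiff₁ (dz (Mc j w)) z := by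
    rw [r2a, show (fun κ z => ∑' w, ∑ j ∈ J, c j w * dz (Mc j w) κ z)
        = fun κ z => ∑' w, (fun w κ z => ∑ j ∈ J, c j w * dz (Mc j w) κ z) w κ z from rfl,
      codiff₁_tsum (f := fun w κ z => ∑ j ∈ J, c j w * dz (Mc j w) κ z) sdM]
    funext z
    exact tsum_congr fun w => by rw [codiff₁_finsum_mul]
  have r2 : dz (codiff₁ (dz (sup0 J c Mc))) = fun κ z => ∑' w, ∑ j ∈ J, c j w * dz (codiff₁ (dz (Mc j w))) κ z := by
    rw [r2b, show (fun z => ∑' w, ∑ j ∈ J, c j w * codiff₁ (dz (Mc j w)) z)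
        = fun z => ∑' w, (fun w z => ∑ j ∈ J, c j w * codiff₁ (dz (Mc j w)) z) w z from rfl,
      dz_tsum (f := fun w z => ∑ j ∈ J, c j w * codiff₁ (dz (Mc j w)) z) scdM]
    funext κ z
    exact tsum_congr fun w => by rw [dz_finsum_mul]
  -- assemble
  rw [h2, r1, r2]
  funext μ z
  simp only [Pi.add_apply]
  rw [tsum_congr (fun w => h3 w μ z), ((scsa μ z).add (sdcdM μ z)).tsum_add (sf μ z),
    (scsa μ z).tsum_add (sdcdM μ z)]
  rfl

/-- **(G) OF A SUPERPOSITION.** [folklore] -/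
theorem isBlockConst_sup1 {N : ℕ} (J : Finset β) {c : β → AffineAveraging.Site D → ℝ} (hc : ∀ j, Summable (c j))
    {X : β → AffineAveraging.Site D → Form1 D ℝ} {C : ℝ} (hX : ∀ j w κ x, |X j w κ x| ≤ C)
    (hG : ∀ j w, IsBlockConst N (codiff₁ (dz (codiff₁ (X j w))))) :
    IsBlockConst N (codiff₁ (dz (codiff₁ (sup1 J c X)))) := by
  have sX : ∀ κ x, Summable fun w => ∑ j ∈ J, c j w * X j w κ x :=
    fun κ x => summable_finsum_mul J hc fun j w => hX j w κ x
  have scd : ∀ x, Summable fun w => ∑ j ∈ J, c j w * codiff₁ (X j w) x :=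
    fun x => summable_finsum_mul J hc fun j w => abs_codiff₁_le (hX j w) x
  have sdcd : ∀ κ x, Summable fun w => ∑ j ∈ J, c j w * dz (codiff₁ (X j w)) κ x :=
    fun κ x => summable_finsum_mul J hc fun j w => abs_dz_le (fun x => abs_codiff₁_le (hX j w) x) κ x
  have e1 : codiff₁ (sup1 J c X) = fun x => ∑' w, ∑ j ∈ J, c j w * codiff₁ (X j w) x := by
    rw [show sup1 J c X = fun κ x => ∑' w, (fun w κ x => ∑ j ∈ J, c j w * X j w κ x) w κ x from rfl,
      codiff₁_tsum (f := fun w κ x => ∑ j ∈ J, c j w * X j w κ x) sX]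
    funext x
    exact tsum_congr fun w => by rw [codiff₁_finsum_mul]
  have e2 : dz (codiff₁ (sup1 J c X)) = fun κ x => ∑' w, ∑ j ∈ J, c j w * dz (codiff₁ (X j w)) κ x := by
    rw [e1, show (fun x => ∑' w, ∑ j ∈ J, c j w * codiff₁ (X j w) x)
        = fun x => ∑' w, (fun w x => ∑ j ∈ J, c j w * codiff₁ (X j w) x) w x from rfl,
      dz_tsum (f := fun w x => ∑ j ∈ J, c j w * codiff₁ (X j w) x) scd]
    funext κ x
    exact tsum_congr fun w => by rw [dz_finsum_mul]
  have e3 : codiff₁ (dz (codiff₁ (sup1 J c X))) = fun x => ∑' w, ∑ j ∈ J, c j w * codiff₁ (dz (codiff₁ (X j w))) x := by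
    rw [e2, show (fun κ x => ∑' w, ∑ j ∈ J, c j w * dz (codiff₁ (X j w)) κ x)
        = fun κ x => ∑' w, (fun w κ x => ∑ j ∈ J, c j w * dz (codiff₁ (X j w)) κ x) w κ x from rfl,
      codiff₁_tsum (f := fun w κ x => ∑ j ∈ J, c j w * dz (codiff₁ (X j w)) κ x) sdcd]
    funext x
    exact tsum_congr fun w => by rw [codiff₁_finsum_mul]
  intro y b hb
  rw [e3]
  exact tsum_congr fun w => Finset.sum_congr rfl fun j _ => by rw [hG j w y b hb]

/-- **(M) OF A SUPERPOSITION.** [folklore] -/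
theorem blockSum_sup0 {N : ℕ} (J : Finset β) {c : β → AffineAveraging.Site D → ℝ} (hc : ∀ j, Summable (c j))
    {Mc : β → AffineAveraging.Site D → Form0 D ℝ} {C : ℝ} (hM : ∀ j w z, |Mc j w z| ≤ C)
    (hMM : ∀ j w y, blockSum N (Mc j w) y = 0) (y : AffineAveraging.Site D) : blockSum N (sup0 J c Mc) y = 0 := by
  have sM : ∀ z, Summable fun w => ∑ j ∈ J, c j w * Mc j w z := fun z => summable_finsum_mul J hc fun j w => hM j w z
  rw [show sup0 J c Mc = fun z => ∑' w, (fun w z => ∑ j ∈ J, c j w * Mc j w z) w z from rfl,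
    blockSum_tsum (f := fun w z => ∑ j ∈ J, c j w * Mc j w z) N sM]
  have h0 : ∀ w, blockSum N (fun z => ∑ j ∈ J, c j w * Mc j w z) y = 0 := fun w => by
    rw [blockSum_finsum_mul]
    exact Finset.sum_eq_zero fun j _ => by rw [hMM j w y, mul_zero]
  simp only [h0, tsum_zero]

/-- **A GAUGE MULTIPLIER WITH ZERO BLOCK SUMS AND CO-CLOSED FORCE VANISHES** — the argument of §7's
`McolSum_eq_zero` with the field left abstract: from `d*d U = 𝒬ᵀΦ + ∂δ₁∂μ + a`, `codiff₁ a = 0`, `blockSum μ = 0`,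
`μ` bounded and summable, `Φ` bounded, conclude `μ = 0`. [folklore] -/
theorem gaugeMult_eq_zero [NeZero N] {U a Φ : Form1 (d + 1) ℝ} {μ : Form0 (d + 1) ℝ} {K : ℝ}
    (hΦb : ∀ κ q, |Φ κ q| ≤ K) (hμb : ∀ z, |μ z| ≤ K) (hμs : Summable μ) (hM : ∀ y, blockSum N μ y = 0)
    (hco : codiff₁ a = 0) (hEL : curvAdj (curv U) = contourSumAdj N Φ + dz (codiff₁ (dz μ)) + a) : μ = 0 := by
  have hg : codiff₁ (dz (codiff₁ (dz μ))) = -codiff₁ (contourSumAdj N Φ) := by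
    have h := congrArg codiff₁ hEL
    rw [codiff₁_curvAdj, codiff₁_add, codiff₁_add, hco, add_zero] at h
    exact eq_neg_of_add_eq_zero_right h.symm
  have hgc : IsBlockConst N (codiff₁ (dz (codiff₁ (dz μ)))) := by
    intro y b hb
    rw [hg, Pi.neg_apply, Pi.neg_apply, isBlockConst_codiff₁_contourSumAdj _ y b hb]
  have hgb : ∀ x, |codiff₁ (dz (codiff₁ (dz μ))) x| ≤ (d + 1 : ℕ) * (2 * K) := by
    intro x
    rw [hg, Pi.neg_apply, abs_neg, codiff₁_contourSumAdj]
    exact abs_codiff₁_le hΦb _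
  -- step 1: `∑' g·μ = 0`
  have hsum0 : ∑' x, codiff₁ (dz (codiff₁ (dz μ))) x * μ x = 0 :=
    tsum_mul_eq_zero_of_blockConst (N := N) hgb hgc hμs hM
  -- step 2: two adjunctions
  have hdzμ : ∀ κ, Summable (dz μ κ) := fun κ => summable_dz hμs κ
  have hΔ : Summable (codiff₁ (dz μ)) := summable_codiff₁ hdzμ
  have hdzΔ : ∀ κ, Summable (dz (codiff₁ (dz μ)) κ) := fun κ => summable_dz hΔ κ
  have hdzμb : ∀ κ x, |dz μ κ x| ≤ 2 * K := fun κ x => abs_dz_le hμb κ x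
  have hΔb : ∀ x, |codiff₁ (dz μ) x| ≤ (d + 1 : ℕ) * (2 * (2 * K)) := fun x => abs_codiff₁_le hdzμb x
  have e1 : lip0 μ (codiff₁ (dz (codiff₁ (dz μ)))) = lip1 (dz μ) (dz (codiff₁ (dz μ))) := lip0_codiff₁ hμb hdzΔ
  have e2 : lip1 (dz μ) (dz (codiff₁ (dz μ))) = lip0 (codiff₁ (dz μ)) (codiff₁ (dz μ)) := lip1_dz hdzμb hΔ
  have e0 : lip0 μ (codiff₁ (dz (codiff₁ (dz μ)))) = 0 := by
    unfold lip0
    rw [← hsum0]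
    exact tsum_congr (fun x => mul_comm _ _)
  have hsq : ∑' x, codiff₁ (dz μ) x * codiff₁ (dz μ) x = 0 := by
    have h := e0
    rw [e1, e2] at h
    exact h
  -- step 3: `Δ₀ μ = 0`
  have hΔ0 : codiff₁ (dz μ) = 0 := by
    have hnn : ∀ x, 0 ≤ codiff₁ (dz μ) x * codiff₁ (dz μ) x := fun x => mul_self_nonneg _
    have hs2 : Summable (fun x => codiff₁ (dz μ) x * codiff₁ (dz μ) x) := summable_mul_of_bdd hΔb hΔ
    have hz := (hasSum_zero_iff_of_nonneg hnn).1 (by rw [← hsq]; exact hs2.hasSum)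
    funext x
    exact mul_self_eq_zero.mp (congr_fun hz x)
  -- step 4: `∑ |dμ|² = ⟨dμ, dμ⟩ = ⟨Δ₀ μ, μ⟩ = 0`
  have e3 : lip1 (dz μ) (dz μ) = lip0 (codiff₁ (dz μ)) μ := lip1_dz hdzμb hμs
  have hsq1 : ∑' x, ∑ κ, dz μ κ x * dz μ κ x = 0 := by
    have h := e3
    rw [hΔ0] at h
    unfold lip1 lip0 at h
    simpa using h
  have hdz0 : ∀ κ x, dz μ κ x = 0 := by
    have hnn : ∀ x, 0 ≤ ∑ κ, dz μ κ x * dz μ κ x := fun x => Finset.sum_nonneg fun κ _ => mul_self_nonneg _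
    have hs3 : Summable (fun x => ∑ κ, dz μ κ x * dz μ κ x) :=
      summable_sum fun κ _ => summable_mul_of_bdd (hdzμb κ) (hdzμ κ)
    have hz := (hasSum_zero_iff_of_nonneg hnn).1 (by rw [← hsq1]; exact hs3.hasSum)
    intro κ x
    have hx : ∑ κ, dz μ κ x * dz μ κ x = 0 := congr_fun hz x
    exact mul_self_eq_zero.mp
      ((Finset.sum_eq_zero_iff_of_nonneg (fun κ _ => mul_self_nonneg (dz μ κ x))).1 hx κ (Finset.mem_univ κ))
  -- step 5: translation invariance + summability
  have hinv : ∀ x, μ (x + unitVec 0) = μ x := fun x => by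
    have h := hdz0 0 x
    simp only [dz] at h
    linarith
  have hv : (unitVec 0 : AffineAveraging.Site (d + 1)) ≠ 0 := by
    intro h
    have := congr_fun h 0
    simp [unitVec_apply] at this
  exact eq_zero_of_summable_of_shift_invariant hμs hv hinv

end Superposition


/-! ### §9.4 The field `V_ζ = Γ_{N′} 𝒬_Mᵀ ζ` as a superposition of contour-summed columns

For a summable, bounded, CO-CLOSED coarse 1-form `ζ` (the case of interest: `ζ = ℋ_Mᵀ F′` for a co-closed test form
`F′`, co-closed by §8 (S2)) the fine field `V_ζ := Σ'_w Σ_{j = (ν, b, s)} ζ(ν, w) Γ_{N′}(·; ν, M•w + b + s•e_ν)` has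
force `𝒬_Mᵀ ζ` (adjunction at the level of indicator forms), NO gauge term (`gaugeMult_eq_zero`), and therefore,
by `decomposition_of_EL` and (Q) of `Γ_M`, is a pure superposition of minimisers:
`V_ζ(κ, x) = Σ'_{z′} Σ_μ (𝒬_M V_ζ)(μ, z′) wH_M κ μ (x − M•z′)` with `(𝒬_M V_ζ)(μ, z′) = Σ'_w Σ_ν ζ(ν, w) GQ(μ, z′; ν, w)`. -/

section Field

/-- The index set of one straight block contour: direction `ν`, offset `b ∈ box`, step `s < M`. [folklore] -/
def Jset (d M : ℕ) : Finset (Fin (d + 1) × ((Fin (d + 1) → ℕ) × ℕ)) :=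
  Finset.univ ×ˢ (box (d + 1) M ×ˢ Finset.range M)

/-- The bond point `M•w + b + s•e_ν` of the contour index `j = (ν, b, s)` over the coarse site `w`. [folklore] -/
def bpt (M : ℕ) (j : Fin (d + 1) × ((Fin (d + 1) → ℕ) × ℕ)) (w : AffineAveraging.Site (d + 1)) :
    AffineAveraging.Site (d + 1) :=
  (M : ℤ) • w + toSite j.2.1 + (j.2.2 : ℤ) • unitVec j.1

/-- `Σ_{j ∈ J} c(j.1) A(j.1, bpt j w) = Σ_ν c(ν) (𝒬_M A)(ν, w)`. [folklore] -/
theorem sum_Jset_contour (M : ℕ) (cw : Fin (d + 1) → ℝ) (A : Form1 (d + 1) ℝ) (w : AffineAveraging.Site (d + 1)) :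
    ∑ j ∈ Jset d M, cw j.1 * A j.1 (bpt M j w) = ∑ ν, cw ν * contourSum M A ν w := by
  rw [Jset, Finset.sum_product]
  refine Finset.sum_congr rfl fun ν _ => ?_
  rw [Finset.sum_product]
  simp only [contourSum, bpt, Finset.mul_sum]

/-- The coefficient family `c_j(w) = ζ(j.1, w)`. [folklore] -/
def cz (ζ : Form1 (d + 1) ℝ) : Fin (d + 1) × ((Fin (d + 1) → ℕ) × ℕ) → AffineAveraging.Site (d + 1) → ℝ :=
  fun j w => ζ j.1 w

/-- `V_ζ = Γ_N 𝒬_Mᵀ ζ` as a superposition of columns of `Γ_N`. [folklore] -/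
def VF [NeZero N] (M : ℕ) (ζ : Form1 (d + 1) ℝ) : Form1 (d + 1) ℝ :=
  sup1 (Jset d M) (cz ζ) (fun j w => Gcol (N := N) j.1 (bpt M j w))

/-- Its constraint multiplier. [folklore] -/
def ΦVF [NeZero N] (M : ℕ) (ζ : Form1 (d + 1) ℝ) : Form1 (d + 1) ℝ :=
  sup1 (Jset d M) (cz ζ) (fun j w => Φcol (N := N) j.1 (bpt M j w))

/-- Its gauge multiplier (shown to vanish for co-closed `ζ`). [folklore] -/
def mVF [NeZero N] (M : ℕ) (ζ : Form1 (d + 1) ℝ) : Form0 (d + 1) ℝ :=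
  sup0 (Jset d M) (cz ζ) (fun j w => Mcol (N := N) j.1 (bpt M j w))

/-- Its force `Σ'_w Σ_j ζ(j.1, w) δ_{(j.1, bpt j w)}` (`= 𝒬_Mᵀ ζ`, `fVF_eq`). [folklore] -/
def fVF (M : ℕ) (ζ : Form1 (d + 1) ℝ) : Form1 (d + 1) ℝ :=
  sup1 (Jset d M) (cz ζ) (fun j w => δcol j.1 (bpt M j w))

/-- `|δ| ≤ 1`. [folklore] -/
theorem abs_δcol_le (l μ : Fin (d + 1)) (x' x : AffineAveraging.Site (d + 1)) : |δcol l x' μ x| ≤ 1 := by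
  unfold δcol
  split_ifs <;> simp

/-- `δ_{(l, x′)}(μ, x) = δ_{(μ, x)}(l, x′)`. [folklore] -/
theorem δcol_symm (l μ : Fin (d + 1)) (x' x : AffineAveraging.Site (d + 1)) : δcol l x' μ x = δcol μ x l x' := by
  unfold δcol
  by_cases h : μ = l ∧ x = x'
  · rw [if_pos h, if_pos ⟨h.1.symm, h.2.symm⟩]
  · rw [if_neg h, if_neg fun h' => h ⟨h'.1.symm, h'.2.symm⟩]

/-- `⟨δ_{(μ, z)}, B⟩ = B(μ, z)`. [folklore] -/
theorem lip1_δcol_left (B : Form1 (d + 1) ℝ) (μ : Fin (d + 1)) (z : AffineAveraging.Site (d + 1)) :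
    lip1 (δcol μ z) B = B μ z := by
  unfold lip1
  have e : ∀ x, ∑ κ, δcol μ z κ x * B κ x = if x = z then B μ z else 0 := by
    intro x
    by_cases hx : x = z
    · subst hx
      rw [if_pos rfl, Finset.sum_eq_single μ (fun κ _ hκ => by simp [δcol, hκ]) (fun h => absurd (Finset.mem_univ μ) h)]
      simp [δcol]
    · rw [if_neg hx]
      exact Finset.sum_eq_zero fun κ _ => by simp [δcol, hx]
  rw [tsum_congr e, tsum_eq_single z (fun x hx => if_neg hx), if_pos rfl]

/-- The components of `δ_{(μ, z)}` are summable. [folklore] -/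
theorem summable_δcol (μ : Fin (d + 1)) (z : AffineAveraging.Site (d + 1)) (κ : Fin (d + 1)) : Summable (δcol μ z κ) := by
  refine summable_of_ne_finset_zero (s := {z}) fun x hx => ?_
  rw [Finset.mem_singleton] at hx
  simp [δcol, hx]

/-- `⟨Γ_N(·; κ₀, x₀), 𝒬ᵀ_N φ⟩ = 0` for bounded `φ` ((Q) of `Γ_N`). [folklore] -/
theorem lip1_Gcol_contourSumAdj_bdd [NeZero N] {φ : Form1 (d + 1) ℝ} {Kφ : ℝ} (hφ : ∀ κ y, |φ κ y| ≤ Kφ)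
    (κ₀ : Fin (d + 1)) (x₀ : AffineAveraging.Site (d + 1)) : lip1 (Gcol (N := N) κ₀ x₀) (contourSumAdj N φ) = 0 := by
  obtain ⟨C, _, _, hsum⟩ := Gcol_bdd_summable (N := N) (d := d)
  rw [lip1_contourSumAdj (N := N) (hsum κ₀ x₀) hφ]
  have hQ : ∀ κ y, contourSum N (Gcol (N := N) κ₀ x₀) κ y = 0 := fun κ y => by
    rw [show Gcol (N := N) κ₀ x₀ = (fun κ z => Gam (N := N) κ z κ₀ x₀) from rfl]
    exact Gam_Q (N := N) κ₀ x₀ κ y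
  simp only [hQ, mul_zero, Finset.sum_const_zero, tsum_zero]

/-- **THE FORCE OF `V_ζ` IS `𝒬_Mᵀ ζ`** (adjunction on indicator forms). [folklore] -/
theorem fVF_eq (M : ℕ) [NeZero M] {ζ : Form1 (d + 1) ℝ} {Kζ : ℝ} (hζb : ∀ ν w, |ζ ν w| ≤ Kζ) :
    fVF (d := d) M ζ = contourSumAdj M ζ := by
  funext μ z
  calc fVF (d := d) M ζ μ z = ∑' w, ∑ ν, ζ ν w * contourSum M (δcol μ z) ν w := by
        unfold fVF sup1 cz
        refine tsum_congr fun w => ?_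
        rw [sum_Jset_contour M (fun ν => ζ ν w) (fun ν p => δcol ν p μ z) w]
        refine Finset.sum_congr rfl fun ν _ => ?_
        rw [show (fun ν p => δcol ν p μ z) = δcol μ z from funext fun ν => funext fun p => δcol_symm ν μ p z]
    _ = lip1 (δcol μ z) (contourSumAdj M ζ) := (lip1_contourSumAdj (N := M) (summable_δcol μ z) hζb).symm
    _ = contourSumAdj M ζ μ z := lip1_δcol_left _ μ z

/-- (EL) of `V_ζ`, with gauge term. [folklore] -/
theorem VF_EL [NeZero N] (M : ℕ) {ζ : Form1 (d + 1) ℝ} (hζs : ∀ ν, Summable (ζ ν)) :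
    curvAdj (curv (VF (N := N) M ζ))
      = contourSumAdj N (ΦVF (N := N) M ζ) + dz (codiff₁ (dz (mVF (N := N) M ζ))) + fVF M ζ := by
  obtain ⟨CΓ, hCΓ, hGb, _⟩ := Gcol_bdd_summable (N := N) (d := d)
  obtain ⟨CM, hCM, hMb, _⟩ := Mcol_bdd_summable (N := N) (d := d)
  obtain ⟨CΦ, hCΦ, hΦb⟩ := Φcol_bdd (N := N) (d := d)
  exact curvAdj_curv_sup1 (C := CΓ + CΦ + CM + 1) (Jset d M) (fun j => hζs j.1)
    (fun j w κ x => (hGb _ _ κ x).trans (by linarith)) (fun j w κ q => (hΦb _ _ κ q).trans (by linarith))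
    (fun j w z => (hMb _ _ z).trans (by linarith)) (fun j w κ x => (abs_δcol_le _ _ _ _).trans (by linarith))
    (fun j w => curvAdj_curv_Gcol (N := N) j.1 (bpt M j w))

/-- (G) of `V_ζ`. [folklore] -/
theorem VF_G [NeZero N] (M : ℕ) {ζ : Form1 (d + 1) ℝ} (hζs : ∀ ν, Summable (ζ ν)) :
    IsBlockConst N (codiff₁ (dz (codiff₁ (VF (N := N) M ζ)))) := by
  obtain ⟨CΓ, _, hGb, _⟩ := Gcol_bdd_summable (N := N) (d := d)
  refine isBlockConst_sup1 (Jset d M) (fun j => hζs j.1) (fun j w κ x => hGb _ _ κ x) fun j w => ?_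
  have h := Gam_G (N := N) j.1 (bpt M j w)
  rwa [show (fun κ z => Gam (N := N) κ z j.1 (bpt M j w)) = Gcol (N := N) j.1 (bpt M j w) from rfl] at h

/-- Bounds and summability of `V_ζ` and of its multipliers. [folklore] -/
theorem VF_bdd [NeZero N] (M : ℕ) {ζ : Form1 (d + 1) ℝ} (hζs : ∀ ν, Summable (ζ ν)) :
    ∃ K : ℝ, (∀ κ x, |VF (N := N) M ζ κ x| ≤ K) ∧ (∀ κ, Summable (VF (N := N) M ζ κ))
      ∧ (∀ κ q, |ΦVF (N := N) M ζ κ q| ≤ K) ∧ (∀ z, |mVF (N := N) M ζ z| ≤ K) ∧ Summable (mVF (N := N) M ζ) := by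
  obtain ⟨CΓ, hCΓ, hGb, hGs⟩ := Gcol_bdd_summable (N := N) (d := d)
  obtain ⟨CM, hCM, hMb, hMs⟩ := Mcol_bdd_summable (N := N) (d := d)
  obtain ⟨CΦ, hCΦ, hΦb⟩ := Φcol_bdd (N := N) (d := d)
  obtain ⟨δ, Cd, hδ, _, hdec⟩ := decay_Gam (N := N) (d := d)
  obtain ⟨δ', C', hδ', _, h'⟩ := decay_wΓμ (N := N) (d := d)
  have hc : ∀ j, Summable (cz ζ j) := fun j => hζs j.1
  have hl := l1n_nonneg (Jset d M) (cz ζ)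
  refine ⟨(CΓ + CΦ + CM) * l1n (Jset d M) (cz ζ), fun κ x => ?_, fun κ => ?_, fun κ q => ?_, fun z => ?_, ?_⟩
  · exact (abs_sup1_le (Jset d M) hc (fun j w κ x => hGb j.1 (bpt M j w) κ x) κ x).trans
      (mul_le_mul_of_nonneg_right (by linarith) hl)
  · exact summable_sup1 (Jset d M) hc (fun j w κ => hGs j.1 (bpt M j w) κ)
      (fun j w κ => tsum_abs_le_of_exp_bound hδ (bpt M j w) (fun x => hdec κ x j.1 (bpt M j w))) κ
  · exact (abs_sup1_le (Jset d M) hc (fun j w κ q => hΦb j.1 (bpt M j w) κ q) κ q).trans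
      (mul_le_mul_of_nonneg_right (by linarith) hl)
  · exact (abs_sup0_le (Jset d M) hc (fun j w z => hMb j.1 (bpt M j w) z) z).trans
      (mul_le_mul_of_nonneg_right (by linarith) hl)
  · exact summable_sup0 (Jset d M) hc (fun j w => hMs j.1 (bpt M j w))
      (fun j w => tsum_abs_le_of_exp_bound (f := Mcol (N := N) j.1 (bpt M j w)) hδ' ((N : ℤ) • quo N (bpt M j w))
        (fun z => h' j.1 (Torus.proj N (bpt M j w)) (z - (N : ℤ) • quo N (bpt M j w))))

/-- **NO GAUGE TERM**: `mVF = 0` for co-closed `ζ`. [folklore] -/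
theorem mVF_eq_zero [NeZero N] (M : ℕ) [NeZero M] {ζ : Form1 (d + 1) ℝ} {Kζ : ℝ} (hζs : ∀ ν, Summable (ζ ν))
    (hζb : ∀ ν w, |ζ ν w| ≤ Kζ) (hco : codiff₁ ζ = 0) : mVF (N := N) M ζ = 0 := by
  obtain ⟨K, _, _, hΦb, hμb, hμs⟩ := VF_bdd (N := N) M hζs
  have hMM : ∀ y, blockSum N (mVF (N := N) M ζ) y = 0 := by
    obtain ⟨CM, _, hMb, _⟩ := Mcol_bdd_summable (N := N) (d := d)
    exact fun y => blockSum_sup0 (Jset d M) (fun j => hζs j.1) (fun j w z => hMb j.1 (bpt M j w) z)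
      (fun j w y => GamM_M (N := N) j.1 (bpt M j w) y) y
  have hco' : codiff₁ (fVF (d := d) M ζ) = 0 := by
    rw [fVF_eq M hζb]
    funext x
    rw [codiff₁_contourSumAdj, hco]
    rfl
  exact gaugeMult_eq_zero (N := N) hΦb hμb hμs hMM hco' (VF_EL (N := N) M hζs)

/-- **`V_ζ` IS A PURE SUPERPOSITION OF LEVEL-`M` MINIMISERS** (`N′ = ML`, `ζ` co-closed):
`V_ζ(κ₀, x₀) = Σ'_{w′} Σ_{l″} (𝒬_M V_ζ)(l″, w′) wH_M κ₀ l″ (x₀ − M•w′)`. [folklore] -/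
theorem VF_decomp {N' M L : ℕ} [NeZero N'] [NeZero M] [NeZero L] (hN : N' = M * L) {ζ : Form1 (d + 1) ℝ} {Kζ : ℝ}
    (hζs : ∀ ν, Summable (ζ ν)) (hζb : ∀ ν w, |ζ ν w| ≤ Kζ) (hco : codiff₁ ζ = 0) (κ₀ : Fin (d + 1))
    (x₀ : AffineAveraging.Site (d + 1)) :
    VF (N := N') M ζ κ₀ x₀ = ∑' w' : (Fin (d + 1) → ℤ), ∑ l'' : Fin (d + 1),
      contourSum M (VF (N := N') M ζ) l'' w' * wH (N := M) (d := d) κ₀ l'' (x₀ - (M : ℤ) • w') := by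
  obtain ⟨K, hUb, hUs, hΦb, _, _⟩ := VF_bdd (N := N') M hζs
  have hEL : curvAdj (curv (VF (N := N') M ζ)) = contourSumAdj N' (ΦVF (N := N') M ζ) + fVF M ζ := by
    rw [VF_EL (N := N') M hζs, mVF_eq_zero (N := N') M hζs hζb hco]
    have h0 : dz (codiff₁ (dz (0 : Form0 (d + 1) ℝ))) = 0 := by
      funext κ x
      simp [dz, codiff₁]
    rw [h0, add_zero]
  have hab : ∀ μ x, |fVF (d := d) M ζ μ x| ≤ M * Kζ := fun μ x => by
    rw [fVF_eq M hζb]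
    exact abs_contourSumAdj_le hζb μ x
  have hK : 0 ≤ K := (abs_nonneg _).trans (hUb 0 0)
  have hK' : 0 ≤ (M : ℝ) * Kζ := mul_nonneg (Nat.cast_nonneg M) ((abs_nonneg _).trans (hζb 0 0))
  have h := decomposition_of_EL hN (K := K + M * Kζ) (fun μ x => (hUb μ x).trans (le_add_of_nonneg_right hK')) hUs
    (fun κ y => (hΦb κ y).trans (le_add_of_nonneg_right hK')) (fun μ x => (hab μ x).trans (le_add_of_nonneg_left hK))
    hEL (VF_G (N := N') M hζs) κ₀ x₀
  rw [h, fVF_eq M hζb, lip1_Gcol_contourSumAdj_bdd (N := M) hζb, zero_add]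

/-- Commuting two pairs of finite sums. [folklore] -/
theorem sum4_comm {α β γ ε : Type*} (A : Finset α) (B : Finset β) (C : Finset γ) (E : Finset ε)
    (f : α → β → γ → ε → ℝ) :
    ∑ a ∈ A, ∑ b ∈ B, ∑ c ∈ C, ∑ e ∈ E, f a b c e = ∑ c ∈ C, ∑ e ∈ E, ∑ a ∈ A, ∑ b ∈ B, f a b c e := by
  calc ∑ a ∈ A, ∑ b ∈ B, ∑ c ∈ C, ∑ e ∈ E, f a b c e
      = ∑ a ∈ A, ∑ c ∈ C, ∑ e ∈ E, ∑ b ∈ B, f a b c e := by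
        refine Finset.sum_congr rfl fun a _ => ?_
        rw [Finset.sum_comm]
        exact Finset.sum_congr rfl fun c _ => Finset.sum_comm
    _ = ∑ c ∈ C, ∑ a ∈ A, ∑ e ∈ E, ∑ b ∈ B, f a b c e := Finset.sum_comm
    _ = ∑ c ∈ C, ∑ e ∈ E, ∑ a ∈ A, ∑ b ∈ B, f a b c e := Finset.sum_congr rfl fun c _ => Finset.sum_comm

/-- `GQ` is symmetric (from `Γ`'s symmetry). [folklore] -/
theorem GQ_symm [NeZero N] (M : ℕ) (μ : Fin (d + 1)) (z' : AffineAveraging.Site (d + 1)) (ν : Fin (d + 1))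
    (w' : AffineAveraging.Site (d + 1)) : GQ (N := N) M μ z' ν w' = GQ (N := N) M ν w' μ z' := by
  simp only [GQ, contourSum, Gcol]
  rw [sum4_comm]
  exact Finset.sum_congr rfl fun b' _ => Finset.sum_congr rfl fun s' _ => Finset.sum_congr rfl fun b _ =>
    Finset.sum_congr rfl fun s _ => Gam_symm (N := N) _ _ _ _

/-- `|𝒬_M A| ≤ |box|·M·C` for `|A| ≤ C`. [folklore] -/
theorem abs_contourSum_le {D M : ℕ} {A : Form1 D ℝ} {C : ℝ} (hA : ∀ κ x, |A κ x| ≤ C) (κ : Fin D)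
    (y : AffineAveraging.Site D) : |contourSum M A κ y| ≤ (box D M).card * (M * C) := by
  simp only [contourSum]
  refine (Finset.abs_sum_le_sum_abs _ _).trans ?_
  refine (Finset.sum_le_sum fun b _ => (Finset.abs_sum_le_sum_abs _ _).trans
    (Finset.sum_le_sum fun s _ => hA κ _)).trans ?_
  simp only [Finset.sum_const, Finset.card_range, nsmul_eq_mul]
  exact le_rfl

/-- `GQ` is bounded. [folklore] -/
theorem GQ_bdd [NeZero N] (M : ℕ) : ∃ G₀ : ℝ, ∀ (μ : Fin (d + 1)) (z' : AffineAveraging.Site (d + 1)) (ν : Fin (d + 1))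
      (w' : AffineAveraging.Site (d + 1)), |GQ (N := N) M μ z' ν w'| ≤ G₀ := by
  obtain ⟨CΓ, _, hGb, _⟩ := Gcol_bdd_summable (N := N) (d := d)
  refine ⟨(box (d + 1) M).card * (M * ((box (d + 1) M).card * (M * CΓ))), fun μ z' ν w' => ?_⟩
  unfold GQ
  exact abs_contourSum_le (fun μ' p => abs_contourSum_le (hGb μ' p) ν w') μ z'

/-- **`𝒬_M V_ζ = GQ ζ`**: `(𝒬_M V_ζ)(μ, z′) = Σ'_w Σ_ν ζ(ν, w) GQ(μ, z′; ν, w)`. [folklore] -/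
theorem contourSum_VF [NeZero N] (M : ℕ) {ζ : Form1 (d + 1) ℝ} (hζs : ∀ ν, Summable (ζ ν)) (μ : Fin (d + 1))
    (z' : AffineAveraging.Site (d + 1)) :
    contourSum M (VF (N := N) M ζ) μ z' = ∑' w, ∑ ν, ζ ν w * GQ (N := N) M μ z' ν w := by
  obtain ⟨CΓ, _, hGb, _⟩ := Gcol_bdd_summable (N := N) (d := d)
  have sX : ∀ κ x, Summable fun w => ∑ j ∈ Jset d M, cz ζ j w * Gcol (N := N) j.1 (bpt M j w) κ x :=
    fun κ x => summable_finsum_mul (Jset d M) (fun j => hζs j.1) fun j w => hGb j.1 (bpt M j w) κ x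
  unfold VF sup1
  rw [contourSum_tsum (fun w κ x => ∑ j ∈ Jset d M, cz ζ j w * Gcol (N := N) j.1 (bpt M j w) κ x) sX]
  refine tsum_congr fun w => ?_
  rw [show (fun κ x => ∑ j ∈ Jset d M, cz ζ j w * Gcol (N := N) j.1 (bpt M j w) κ x)
      = fun κ x => ∑ j ∈ Jset d M, (fun j κ' x' => cz ζ j w * Gcol (N := N) j.1 (bpt M j w) κ' x') j κ x from rfl,
    contourSum_finset_sum]
  simp only [contourSum_const_mul]
  unfold cz
  rw [sum_Jset_contour M (fun ν => ζ ν w) (fun ν p => contourSum M (Gcol (N := N) ν p) μ z') w]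
  refine Finset.sum_congr rfl fun ν _ => ?_
  rw [GQ_symm]
  rfl

/-! ### §9.5 Pairings with test forms -/

/-- `ζ_F(μ, z′) := Σ_{x ∈ s} Σ_κ F(κ, x) wH_M κ μ (x − M•z′)` (`= ⟨F, ℋ_M(·; μ, z′)⟩` for `F` supported in `s`). [folklore] -/
def zeta (M : ℕ) [NeZero M] (F : Form1 (d + 1) ℝ) (s : Finset (AffineAveraging.Site (d + 1))) : Form1 (d + 1) ℝ :=
  fun μ z' => ∑ x ∈ s, ∑ κ, F κ x * wH (N := M) (d := d) κ μ (x - (M : ℤ) • z')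

/-- `ζ_F` has summable components. [folklore] -/
theorem summable_zeta (M : ℕ) [NeZero M] (F : Form1 (d + 1) ℝ) (s : Finset (AffineAveraging.Site (d + 1)))
    (μ : Fin (d + 1)) : Summable (zeta (d := d) M F s μ) :=
  summable_sum fun x _ => summable_sum fun κ _ => (summable_wH_sub_zsmul M κ μ x).mul_left (F κ x)

/-- `ζ_F` is bounded. [folklore] -/
theorem zeta_bdd (M : ℕ) [NeZero M] (F : Form1 (d + 1) ℝ) (s : Finset (AffineAveraging.Site (d + 1))) :
    ∃ Kζ : ℝ, ∀ μ z', |zeta (d := d) M F s μ z'| ≤ Kζ := by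
  obtain ⟨C, _, hHb, _⟩ := Hcol_bdd_summable (N := M) (d := d)
  refine ⟨∑ x ∈ s, ∑ κ, |F κ x| * C, fun μ z' => ?_⟩
  unfold zeta
  refine (Finset.abs_sum_le_sum_abs _ _).trans (Finset.sum_le_sum fun x _ => ?_)
  refine (Finset.abs_sum_le_sum_abs _ _).trans (Finset.sum_le_sum fun κ _ => ?_)
  rw [abs_mul]
  exact mul_le_mul_of_nonneg_left (hHb μ z' κ x) (abs_nonneg _)

/-- `ζ_F(μ, z′) = ⟨F, ℋ_M(·; μ, z′)⟩` for `F` supported in `s`. [folklore] -/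
theorem zeta_eq_lip1 (M : ℕ) [NeZero M] (F : Form1 (d + 1) ℝ) (s : Finset (AffineAveraging.Site (d + 1)))
    (hs : ∀ κ x, x ∉ s → F κ x = 0) (μ : Fin (d + 1)) (z' : AffineAveraging.Site (d + 1)) :
    zeta (d := d) M F s μ z' = lip1 F (Hcol (N := M) μ z') := by
  unfold zeta lip1
  rw [tsum_eq_sum (s := s) (fun x hx => Finset.sum_eq_zero fun κ _ => by rw [hs κ x hx, zero_mul])]
  rfl

/-- **`ζ_F` IS COARSE CO-CLOSED** for co-closed finitely supported `F` (§8 (S2)). [folklore] -/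
theorem codiff₁_zeta (M : ℕ) [NeZero M] (F : Form1 (d + 1) ℝ) (hF : ∀ κ, (Function.support (F κ)).Finite)
    (s : Finset (AffineAveraging.Site (d + 1))) (hs : ∀ κ x, x ∉ s → F κ x = 0) (hco : codiff₁ F = 0) :
    codiff₁ (zeta (d := d) M F s) = 0 := by
  rw [show zeta (d := d) M F s = fun μ z' => lip1 F (Hcol (N := M) μ z') from
    funext fun μ => funext fun z' => zeta_eq_lip1 M F s hs μ z']
  exact codiff₁_lip1_Hcol (N := M) F hF hco

/-- Exchange of a finite pairing with an absolutely convergent coarse sum. [folklore] -/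
theorem finsum_tsum_comm {α β' : Type*} (s : Finset α) (J : Finset β') (a : Fin (d + 1) → α → ℝ)
    (f : Fin (d + 1) → α → β' → AffineAveraging.Site (d + 1) → ℝ) (hf : ∀ l y, ∀ ν ∈ J, Summable (f l y ν)) :
    ∑ y ∈ s, ∑ l, a l y * ∑' w, ∑ ν ∈ J, f l y ν w = ∑' w, ∑ ν ∈ J, ∑ y ∈ s, ∑ l, a l y * f l y ν w := by
  have hs1 : ∀ y l, Summable fun w => ∑ ν ∈ J, a l y * f l y ν w :=
    fun y l => summable_sum fun ν hν => (hf l y ν hν).mul_left (a l y)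
  symm
  calc ∑' w, ∑ ν ∈ J, ∑ y ∈ s, ∑ l, a l y * f l y ν w
      = ∑' w, ∑ y ∈ s, ∑ l, ∑ ν ∈ J, a l y * f l y ν w := by
        refine tsum_congr fun w => ?_
        rw [Finset.sum_comm]
        exact Finset.sum_congr rfl fun y _ => Finset.sum_comm
    _ = ∑ y ∈ s, ∑' w, ∑ l, ∑ ν ∈ J, a l y * f l y ν w :=
        Summable.tsum_finsetSum fun y _ => summable_sum fun l _ => hs1 y l
    _ = ∑ y ∈ s, ∑ l, ∑' w, ∑ ν ∈ J, a l y * f l y ν w :=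
        Finset.sum_congr rfl fun y _ => Summable.tsum_finsetSum fun l _ => hs1 y l
    _ = ∑ y ∈ s, ∑ l, a l y * ∑' w, ∑ ν ∈ J, f l y ν w := by
        refine Finset.sum_congr rfl fun y _ => Finset.sum_congr rfl fun l _ => ?_
        rw [← tsum_mul_left]
        exact tsum_congr fun w => (Finset.mul_sum _ _ _).symm

/-- **FIRST EVALUATION OF `⟨F, V_ζ⟩`** (via `VF_decomp`):
`Σ_{x ∈ s} Σ_κ F(κ,x) V_ζ(κ,x) = Σ'_{z′} Σ_μ ζ_F(μ, z′) · Σ'_w Σ_ν ζ(ν, w) GQ(μ, z′; ν, w)`. [folklore] -/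
theorem pairF_VF_decomp {N' M L : ℕ} [NeZero N'] [NeZero M] [NeZero L] (hN : N' = M * L) {ζ : Form1 (d + 1) ℝ}
    {Kζ : ℝ} (hζs : ∀ ν, Summable (ζ ν)) (hζb : ∀ ν w, |ζ ν w| ≤ Kζ) (hco : codiff₁ ζ = 0) (F : Form1 (d + 1) ℝ)
    (s : Finset (AffineAveraging.Site (d + 1))) :
    ∑ x ∈ s, ∑ κ, F κ x * VF (N := N') M ζ κ x
      = ∑' z' : (Fin (d + 1) → ℤ), ∑ μ, zeta (d := d) M F s μ z' * ∑' w, ∑ ν, ζ ν w * GQ (N := N') M μ z' ν w := by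
  obtain ⟨G₀, hG₀⟩ := GQ_bdd (N := N') (d := d) M
  -- `T μ z' := Σ'_w Σ_ν ζ ν w GQ(μ z'; ν w)` is bounded
  have hTb : ∀ μ z', |∑' w, ∑ ν, ζ ν w * GQ (N := N') M μ z' ν w| ≤ G₀ * l1n Finset.univ ζ :=
    fun μ z' => abs_tsum_finsum_mul_le Finset.univ hζs (fun ν w => hG₀ μ z' ν w)
  have e : ∀ κ x, VF (N := N') M ζ κ x = ∑' z' : (Fin (d + 1) → ℤ), ∑ μ,
      (∑' w, ∑ ν, ζ ν w * GQ (N := N') M μ z' ν w) * wH (N := M) (d := d) κ μ (x - (M : ℤ) • z') := by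
    intro κ x
    rw [VF_decomp hN hζs hζb hco κ x]
    exact tsum_congr fun z' => Finset.sum_congr rfl fun μ _ => by rw [contourSum_VF (N := N') M hζs]
  simp only [e]
  rw [finsum_tsum_comm s Finset.univ (fun κ x => F κ x)
    (fun κ x μ z' => (∑' w, ∑ ν, ζ ν w * GQ (N := N') M μ z' ν w) * wH (N := M) (d := d) κ μ (x - (M : ℤ) • z'))
    (fun κ x μ _ => summable_mul_of_bdd (fun z' => hTb μ z') (summable_wH_sub_zsmul M κ μ x))]
  refine tsum_congr fun z' => Finset.sum_congr rfl fun μ _ => ?_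
  unfold zeta
  rw [Finset.sum_mul]
  refine Finset.sum_congr rfl fun x _ => ?_
  rw [Finset.sum_mul]
  refine Finset.sum_congr rfl fun κ _ => ?_
  ring

/-- The force of the column combination indexed by `univ ×ˢ s` with coefficients `F` is `F` itself
(for `F` supported in `s`). [folklore] -/
theorem δSum_pair_eq (F : Form1 (d + 1) ℝ) (s : Finset (AffineAveraging.Site (d + 1)))
    (hs : ∀ κ x, x ∉ s → F κ x = 0) : δSum (Finset.univ ×ˢ s) (fun t => F t.1 t.2) = F := by
  funext μ x
  unfold δSum
  by_cases hx : x ∈ s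
  · rw [Finset.sum_eq_single (μ, x) (fun t _ hne => ?_)
      (fun h => absurd (Finset.mem_product.mpr ⟨Finset.mem_univ μ, hx⟩) h)]
    · simp [δcol]
    · have hne' : ¬ (μ = t.1 ∧ x = t.2) := fun h => hne (Prod.ext h.1.symm h.2.symm)
      simp [δcol, hne']
  · rw [hs μ x hx]
    exact Finset.sum_eq_zero fun t ht => by
      have ht2 : t.2 ∈ s := (Finset.mem_product.mp ht).2
      have hne' : ¬ (μ = t.1 ∧ x = t.2) := fun h => hx (h.2 ▸ ht2)
      simp [δcol, hne']

/-- The column combination indexed by `univ ×ˢ s` with coefficients `F` is `Γ_N F`: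
`(Σ_t F_t Γ_t)(l, y) = Σ_{x ∈ s} Σ_κ F(κ, x) Γ_N(κ, x; l, y)`. [folklore] -/
theorem GcolSum_pair_eq [NeZero N] (F : Form1 (d + 1) ℝ) (s : Finset (AffineAveraging.Site (d + 1)))
    (l : Fin (d + 1)) (y : AffineAveraging.Site (d + 1)) :
    GcolSum (N := N) (Finset.univ ×ˢ s) (fun t => F t.1 t.2) l y = ∑ x ∈ s, ∑ κ, F κ x * Gam (N := N) κ x l y := by
  simp only [GcolSum, Gcol]
  rw [Finset.sum_product, Finset.sum_comm]
  exact Finset.sum_congr rfl fun x _ => Finset.sum_congr rfl fun κ _ => by rw [Gam_symm]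

/-- **SECOND EVALUATION OF `⟨F, V_{ζ_{F′}}⟩`** (directly, via the finite decomposition (A) of `Γ_{N′} F`):
`Σ_{x ∈ s} Σ_κ F(κ, x) V_{ζ_{F′}}(κ, x) = Σ_{x ∈ s} Σ_{y ∈ s′} Σ_κ Σ_l F(κ, x) (Γ_{N′} − Γ_M)(κ, x; l, y) F′(l, y)`
for co-closed `F` supported in `s`. [folklore] -/
theorem pairF_VF_direct {N' M L : ℕ} [NeZero N'] [NeZero M] [NeZero L] (hN : N' = M * L) (F F' : Form1 (d + 1) ℝ)
    (s s' : Finset (AffineAveraging.Site (d + 1))) (hs : ∀ κ x, x ∉ s → F κ x = 0) (hcoF : codiff₁ F = 0) :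
    ∑ x ∈ s, ∑ κ, F κ x * VF (N := N') M (zeta (d := d) M F' s') κ x
      = ∑ x ∈ s, ∑ y ∈ s', ∑ κ, ∑ l, F κ x * (Gam (N := N') κ x l y - Gam (N := M) κ x l y) * F' l y := by
  obtain ⟨CΓ, _, hGb, _⟩ := Gcol_bdd_summable (N := N') (d := d)
  set ζ' := zeta (d := d) M F' s' with hζ'
  set a : Fin (d + 1) × AffineAveraging.Site (d + 1) → ℝ := fun t => F t.1 t.2 with ha
  set U' := GcolSum (N := N') (Finset.univ ×ˢ s) a with hU'
  have hζs : ∀ ν, Summable (ζ' ν) := summable_zeta M F' s'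
  -- `|U′| ≤ K'`, hence `|𝒬_M U′|` bounded
  have hU'b : ∀ κ x, |U' κ x| ≤ ∑ t ∈ Finset.univ ×ˢ s, |a t| * CΓ := fun κ x => by
    simp only [hU', GcolSum]
    refine (Finset.abs_sum_le_sum_abs _ _).trans (Finset.sum_le_sum fun t _ => ?_)
    rw [abs_mul]
    exact mul_le_mul_of_nonneg_left (hGb t.1 t.2 κ x) (abs_nonneg _)
  have hQb := fun ν w => abs_contourSum_le (M := M) hU'b ν w
  -- step 1: `⟨F, V⟩ = Σ'_w Σ_ν ζ′(ν, w) (𝒬_M U′)(ν, w)`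
  have h1 : ∑ x ∈ s, ∑ κ, F κ x * VF (N := N') M ζ' κ x = ∑' w, ∑ ν, ζ' ν w * contourSum M U' ν w := by
    unfold VF sup1
    rw [finsum_tsum_comm s (Jset d M) (fun κ x => F κ x)
      (fun κ x j w => cz ζ' j w * Gcol (N := N') j.1 (bpt M j w) κ x)
      (fun κ x j _ => summable_mul_of_bdd' (hζs j.1) (fun w => hGb j.1 (bpt M j w) κ x))]
    refine tsum_congr fun w => ?_
    have e : ∀ j ∈ Jset d M, ∑ x ∈ s, ∑ κ, F κ x * (cz ζ' j w * Gcol (N := N') j.1 (bpt M j w) κ x)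
        = cz ζ' j w * U' j.1 (bpt M j w) := by
      intro j _
      rw [hU', GcolSum_pair_eq, Finset.mul_sum]
      refine Finset.sum_congr rfl fun x _ => ?_
      rw [Finset.mul_sum]
      exact Finset.sum_congr rfl fun κ _ => by simp only [Gcol]; ring
    rw [Finset.sum_congr rfl e]
    exact sum_Jset_contour M (fun ν => ζ' ν w) U' w
  -- step 2: unfold `ζ′` and exchange
  have h2 : ∑' w, ∑ ν, ζ' ν w * contourSum M U' ν w
      = ∑ y ∈ s', ∑ l, F' l y * ∑' w, ∑ ν, contourSum M U' ν w * wH (N := M) (d := d) l ν (y - (M : ℤ) • w) := by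
    rw [finsum_tsum_comm s' Finset.univ (fun l y => F' l y)
      (fun l y ν w => contourSum M U' ν w * wH (N := M) (d := d) l ν (y - (M : ℤ) • w))
      (fun l y ν _ => summable_mul_of_bdd (fun w => hQb ν w) (summable_wH_sub_zsmul M l ν y))]
    refine tsum_congr fun w => Finset.sum_congr rfl fun ν _ => ?_
    rw [hζ']
    unfold zeta
    rw [Finset.sum_mul]
    refine Finset.sum_congr rfl fun y _ => ?_
    rw [Finset.sum_mul]
    exact Finset.sum_congr rfl fun l _ => by ring
  -- step 3: finite decomposition (A) of `U′`
  have hco' : codiff₁ (δSum (Finset.univ ×ˢ s) a) = 0 := by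
    rw [ha, δSum_pair_eq F s hs]
    exact hcoF
  have h3 : ∀ l y, ∑' w, ∑ ν, contourSum M U' ν w * wH (N := M) (d := d) l ν (y - (M : ℤ) • w)
      = U' l y - GcolSum (N := M) (Finset.univ ×ˢ s) a l y := by
    intro l y
    have h := GcolSum_decomposition hN (Finset.univ ×ˢ s) a hco' l y
    rw [hU']
    linarith
  rw [h1, h2]
  simp only [h3]
  simp only [hU', ha, GcolSum_pair_eq]
  -- step 4: finite algebra
  calc ∑ y ∈ s', ∑ l, F' l y * (∑ x ∈ s, ∑ κ, F κ x * Gam (N := N') κ x l y - ∑ x ∈ s, ∑ κ, F κ x * Gam (N := M) κ x l y)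
      = ∑ y ∈ s', ∑ l, ∑ x ∈ s, ∑ κ, F κ x * (Gam (N := N') κ x l y - Gam (N := M) κ x l y) * F' l y := by
        refine Finset.sum_congr rfl fun y _ => Finset.sum_congr rfl fun l _ => ?_
        rw [← Finset.sum_sub_distrib, Finset.mul_sum]
        refine Finset.sum_congr rfl fun x _ => ?_
        rw [← Finset.sum_sub_distrib, Finset.mul_sum]
        exact Finset.sum_congr rfl fun κ _ => by ring
    _ = ∑ x ∈ s, ∑ κ, ∑ y ∈ s', ∑ l, F κ x * (Gam (N := N') κ x l y - Gam (N := M) κ x l y) * F' l y :=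
        sum4_comm _ _ _ _ (fun y l x κ => F κ x * (Gam (N := N') κ x l y - Gam (N := M) κ x l y) * F' l y)
    _ = ∑ x ∈ s, ∑ y ∈ s', ∑ κ, ∑ l, F κ x * (Gam (N := N') κ x l y - Gam (N := M) κ x l y) * F' l y :=
        Finset.sum_congr rfl fun x _ => Finset.sum_comm

/-- **THE TRANSVERSE PAIRING IDENTITY** (the heart of step (B)): for finitely supported co-closed test forms `F`, `F′`
(supported in `s`, `s′`) and `N′ = ML`,
`Σ F (Γ_{N′} − Γ_M) F′ = Σ'_{z′} Σ_μ ζ_F(μ, z′) · Σ'_w Σ_ν ζ_{F′}(ν, w) GQ(μ, z′; ν, w)`. [folklore] -/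
theorem pairing_identity {N' M L : ℕ} [NeZero N'] [NeZero M] [NeZero L] (hN : N' = M * L) (F F' : Form1 (d + 1) ℝ)
    (hF' : ∀ κ, (Function.support (F' κ)).Finite) (s s' : Finset (AffineAveraging.Site (d + 1)))
    (hs : ∀ κ x, x ∉ s → F κ x = 0) (hs' : ∀ κ x, x ∉ s' → F' κ x = 0) (hcoF : codiff₁ F = 0)
    (hcoF' : codiff₁ F' = 0) :
    ∑ x ∈ s, ∑ y ∈ s', ∑ κ, ∑ l, F κ x * (Gam (N := N') κ x l y - Gam (N := M) κ x l y) * F' l y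
      = ∑' z' : (Fin (d + 1) → ℤ), ∑ μ, zeta (d := d) M F s μ z'
          * ∑' w, ∑ ν, zeta (d := d) M F' s' ν w * GQ (N := N') M μ z' ν w := by
  obtain ⟨Kζ, hζb⟩ := zeta_bdd (d := d) M F' s'
  rw [← pairF_VF_direct hN F F' s s' hs hcoF]
  exact pairF_VF_decomp hN (summable_zeta M F' s') hζb (codiff₁_zeta M F' hF' s' hs' hcoF') F s

/-- `PQ(x, y; κ, l) := Σ'_{z′} Σ_μ wH_M κ μ (x − M•z′) · Σ'_{w′} Σ_ν GQ(μ, z′; ν, w′) wH_M l ν (y − M•w′)`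
(minus the `(inl, inl)` entry of `KInv_M ∘ ι(KInvStep) ∘ KInv_M`, `compA_apply`). [folklore] -/
def PQ [NeZero N] (M : ℕ) [NeZero M] (x y : AffineAveraging.Site (d + 1)) (κ l : Fin (d + 1)) : ℝ :=
  ∑' z' : (Fin (d + 1) → ℤ), ∑ μ : Fin (d + 1), wH (N := M) (d := d) κ μ (x - (M : ℤ) • z') *
    ∑' w' : (Fin (d + 1) → ℤ), ∑ ν : Fin (d + 1), GQ (N := N) M μ z' ν w' * wH (N := M) (d := d) l ν (y - (M : ℤ) • w')

/-- **`Σ F PQ F′` IN TERMS OF `ζ_F`, `ζ_{F′}`**: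
`Σ_{x ∈ s} Σ_{y ∈ s′} Σ_κ Σ_l F(κ,x) PQ(x,y;κ,l) F′(l,y) = Σ'_{z′} Σ_μ ζ_F(μ,z′) Σ'_w Σ_ν ζ_{F′}(ν,w) GQ(μ,z′;ν,w)`. [folklore] -/
theorem pair_PQ [NeZero N] (M : ℕ) [NeZero M] (F F' : Form1 (d + 1) ℝ) (s s' : Finset (AffineAveraging.Site (d + 1))) :
    ∑ x ∈ s, ∑ y ∈ s', ∑ κ, ∑ l, F κ x * PQ (N := N) M x y κ l * F' l y
      = ∑' z' : (Fin (d + 1) → ℤ), ∑ μ, zeta (d := d) M F s μ z'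
          * ∑' w, ∑ ν, zeta (d := d) M F' s' ν w * GQ (N := N) M μ z' ν w := by
  obtain ⟨G₀, hG₀⟩ := GQ_bdd (N := N) (d := d) M
  obtain ⟨Kζ, hζb⟩ := zeta_bdd (d := d) M F s
  -- the inner coarse sum `Q l y μ z'` and its bound
  have hQb : ∀ l y μ z', |∑' w', ∑ ν, GQ (N := N) M μ z' ν w' * wH (N := M) (d := d) l ν (y - (M : ℤ) • w')|
      ≤ G₀ * l1n Finset.univ (fun ν w' => wH (N := M) (d := d) l ν (y - (M : ℤ) • w')) := by
    intro l y μ z'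
    rw [show (∑' w', ∑ ν, GQ (N := N) M μ z' ν w' * wH (N := M) (d := d) l ν (y - (M : ℤ) • w'))
        = ∑' w', ∑ ν, wH (N := M) (d := d) l ν (y - (M : ℤ) • w') * GQ (N := N) M μ z' ν w' from
      tsum_congr fun w' => Finset.sum_congr rfl fun ν _ => mul_comm _ _]
    exact abs_tsum_finsum_mul_le Finset.univ (fun ν => summable_wH_sub_zsmul M l ν y) (fun ν w' => hG₀ μ z' ν w')
  -- step 1: reorder the finite sums
  have r1 : ∑ x ∈ s, ∑ y ∈ s', ∑ κ, ∑ l, F κ x * PQ (N := N) M x y κ l * F' l y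
      = ∑ y ∈ s', ∑ l, F' l y * ∑ x ∈ s, ∑ κ, F κ x * PQ (N := N) M x y κ l := by
    calc ∑ x ∈ s, ∑ y ∈ s', ∑ κ, ∑ l, F κ x * PQ (N := N) M x y κ l * F' l y
        = ∑ x ∈ s, ∑ κ, ∑ y ∈ s', ∑ l, F κ x * PQ (N := N) M x y κ l * F' l y :=
          Finset.sum_congr rfl fun x _ => Finset.sum_comm
      _ = ∑ y ∈ s', ∑ l, ∑ x ∈ s, ∑ κ, F κ x * PQ (N := N) M x y κ l * F' l y :=
          sum4_comm _ _ _ _ (fun x κ y l => F κ x * PQ (N := N) M x y κ l * F' l y)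
      _ = ∑ y ∈ s', ∑ l, F' l y * ∑ x ∈ s, ∑ κ, F κ x * PQ (N := N) M x y κ l := by
          refine Finset.sum_congr rfl fun y _ => Finset.sum_congr rfl fun l _ => ?_
          rw [Finset.mul_sum]
          refine Finset.sum_congr rfl fun x _ => ?_
          rw [Finset.mul_sum]
          exact Finset.sum_congr rfl fun κ _ => by ring
  -- step 2: the `x`-pairing
  have r2 : ∀ y l, ∑ x ∈ s, ∑ κ, F κ x * PQ (N := N) M x y κ l = ∑' z' : (Fin (d + 1) → ℤ), ∑ μ,
      zeta (d := d) M F s μ z' * ∑' w', ∑ ν, GQ (N := N) M μ z' ν w' * wH (N := M) (d := d) l ν (y - (M : ℤ) • w') := by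
    intro y l
    unfold PQ
    rw [finsum_tsum_comm s Finset.univ (fun κ x => F κ x)
      (fun κ x μ z' => wH (N := M) (d := d) κ μ (x - (M : ℤ) • z')
        * ∑' w', ∑ ν, GQ (N := N) M μ z' ν w' * wH (N := M) (d := d) l ν (y - (M : ℤ) • w'))
      (fun κ x μ _ => summable_mul_of_bdd' (summable_wH_sub_zsmul M κ μ x) (fun z' => hQb l y μ z'))]
    refine tsum_congr fun z' => Finset.sum_congr rfl fun μ _ => ?_
    unfold zeta
    rw [Finset.sum_mul]
    refine Finset.sum_congr rfl fun x _ => ?_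
    rw [Finset.sum_mul]
    exact Finset.sum_congr rfl fun κ _ => by ring
  -- step 3: the `y`-pairing, outer exchange
  rw [r1]
  simp only [r2]
  rw [finsum_tsum_comm s' Finset.univ (fun l y => F' l y)
    (fun l y μ z' => zeta (d := d) M F s μ z'
      * ∑' w', ∑ ν, GQ (N := N) M μ z' ν w' * wH (N := M) (d := d) l ν (y - (M : ℤ) • w'))
    (fun l y μ _ => summable_mul_of_bdd' (summable_zeta M F s μ) (fun z' => hQb l y μ z'))]
  refine tsum_congr fun z' => Finset.sum_congr rfl fun μ _ => ?_
  -- step 4: the `y`-pairing, inner exchange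
  have r4 : ∑ y ∈ s', ∑ l, F' l y * ∑' w', ∑ ν, GQ (N := N) M μ z' ν w' * wH (N := M) (d := d) l ν (y - (M : ℤ) • w')
      = ∑' w, ∑ ν, zeta (d := d) M F' s' ν w * GQ (N := N) M μ z' ν w := by
    rw [finsum_tsum_comm s' Finset.univ (fun l y => F' l y)
      (fun l y ν w' => GQ (N := N) M μ z' ν w' * wH (N := M) (d := d) l ν (y - (M : ℤ) • w'))
      (fun l y ν _ => summable_mul_of_bdd (fun w' => hG₀ μ z' ν w') (summable_wH_sub_zsmul M l ν y))]
    refine tsum_congr fun w => Finset.sum_congr rfl fun ν _ => ?_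
    unfold zeta
    rw [Finset.sum_mul]
    refine Finset.sum_congr rfl fun y _ => ?_
    rw [Finset.sum_mul]
    exact Finset.sum_congr rfl fun l _ => by ring
  rw [← r4, Finset.mul_sum]
  refine Finset.sum_congr rfl fun y _ => ?_
  rw [Finset.mul_sum]
  exact Finset.sum_congr rfl fun l _ => by ring


end Field


/-! ### §9.6 The composite and (K1aᵀ) at every level -/

variable (Lc : ℕ) [NeZero Lc]

/-- THE `(inl, inl)` ENTRIES OF THE DECIMATED COMPOSITE RESOLVENT (the STEP COVARIANCE): `(L^j)^{−2(d+2)}` times the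
double `L^j`-block-contour sum of `Γ_{L^(j+1)}`. [folklore] -/
theorem KInvStep_inl_inl (j : ℕ) (μ ν : Fin (d + 1)) (z' w' : Fin (d + 1) → ℤ) :
    KInvStep (d := d) Lc j z' w' (Sum.inl μ) (Sum.inl ν)
      = (((Lc ^ j : ℕ) : ℝ) ^ (d + 2))⁻¹ * ((((Lc ^ j : ℕ) : ℝ) ^ (d + 2))⁻¹
          * GQ (N := Lc ^ (j + 1)) (Lc ^ j) μ z' ν w') := by
  unfold KInvStep GQ
  rw [dec_inl_inl, ← sum_LegIdx_eq_contourSum, Finset.mul_sum, Finset.mul_sum]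
  refine Finset.sum_congr rfl fun i _ => ?_
  rw [← sum_LegIdx_eq_contourSum, Finset.mul_sum, Finset.mul_sum]
  refine Finset.sum_congr rfl fun i' _ => ?_
  rw [KInv_inl_inl, show Gcol (N := Lc ^ (j + 1)) μ (legPt (Lc ^ j) (Sum.inl μ) z' i) ν (legPt (Lc ^ j) (Sum.inl ν) w' i')
    = Gam (N := Lc ^ (j + 1)) ν (legPt (Lc ^ j) (Sum.inl ν) w' i') μ (legPt (Lc ^ j) (Sum.inl μ) z' i) from rfl, Gam_symm]
  push_cast
  ring

/-- **THE COMPOSITE OF (K1aᵀ) IS `−ℋ_M (𝒬_M Γ_{ML} 𝒬_Mᵀ) ℋ_Mᵀ`** (`M = L^j`): sublattice re-indexing on both inner points,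
`liftW` pins, `KInvStep_inl_inl`, and `ℋ♭ = −ℋᵀ` on the right leg. [folklore] -/
theorem compA_apply (j : ℕ) (x y : Fin (d + 1) → ℤ) (κ l : Fin (d + 1)) :
    comp (KInv (N := Lc ^ j) (d := d))
        (comp (liftW (Lc ^ j) true true (KInvStep (d := d) Lc j)) (KInv (N := Lc ^ j) (d := d)))
        x y (Sum.inl κ) (Sum.inl l)
      = -∑' z' : (Fin (d + 1) → ℤ), ∑ μ : Fin (d + 1), wH (N := Lc ^ j) (d := d) κ μ (x - ((Lc ^ j : ℕ) : ℤ) • z')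
          * ∑' w' : (Fin (d + 1) → ℤ), ∑ ν : Fin (d + 1), GQ (N := Lc ^ (j + 1)) (Lc ^ j) μ z' ν w'
            * wH (N := Lc ^ j) (d := d) l ν (y - ((Lc ^ j : ℕ) : ℤ) • w') := by
  have hC : (((Lc ^ j : ℕ) : ℝ) ^ (d + 2)) ≠ 0 :=
    pow_ne_zero _ (by exact_mod_cast (pow_pos (Nat.pos_of_ne_zero (NeZero.ne Lc)) j).ne')
  unfold ExpKernelCalculus.comp
  rw [← tsum_neg]
  refine tsum_sublattice₀ (Lc ^ j) _ _ (fun z hz => ?_) (fun z' => ?_)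
  · simp only [liftW_off (Lc ^ j) true true _ (Or.inl hz), zero_mul, Finset.sum_const_zero, tsum_zero, mul_zero]
  · rw [Fintype.sum_sum_type]
    simp only [liftW_inl_left, zero_mul, Finset.sum_const_zero, tsum_zero, mul_zero, zero_add]
    rw [← Finset.sum_neg_distrib]
    refine Finset.sum_congr rfl fun μ _ => ?_
    rw [KInv_inl_inr_coarse, ← mul_neg, ← tsum_neg]
    congr 1
    refine tsum_sublattice₀ (Lc ^ j) _ _ (fun w hw => ?_) (fun w' => ?_)
    · simp only [liftW_off (Lc ^ j) true true _ (Or.inr hw), zero_mul, Finset.sum_const_zero]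
    · rw [Fintype.sum_sum_type]
      simp only [liftW_inl_right, zero_mul, Finset.sum_const_zero, zero_add, liftW_zsmul, KInv_inr_inl_coarse,
        GamΦ_eq_neg_wH, slotW_true, slot_true, KInvStep_inl_inl]
      rw [← Finset.sum_neg_distrib]
      refine Finset.sum_congr rfl fun ν _ => ?_
      field_simp


/-- `compA_apply` in terms of `PQ`: the `(inl, inl)` entry of `KInv_M ∘ ι(KInvStep) ∘ KInv_M` is `−PQ`. [folklore] -/
theorem compA_eq_neg_PQ (j : ℕ) (x y : Fin (d + 1) → ℤ) (κ l : Fin (d + 1)) :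
    comp (KInv (N := Lc ^ j) (d := d))
        (comp (liftW (Lc ^ j) true true (KInvStep (d := d) Lc j)) (KInv (N := Lc ^ j) (d := d)))
        x y (Sum.inl κ) (Sum.inl l) = -PQ (N := Lc ^ (j + 1)) (Lc ^ j) x y κ l :=
  compA_apply Lc j x y κ l

/-- A test-form pairing of a finitely supported pair `F`, `F′` is a finite sum. [folklore] -/
theorem tsum_pair_eq_sum (F F' : Form1 (d + 1) ℝ) (s s' : Finset (AffineAveraging.Site (d + 1)))
    (hs : ∀ κ x, x ∉ s → F κ x = 0) (hs' : ∀ κ x, x ∉ s' → F' κ x = 0)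
    (K : AffineAveraging.Site (d + 1) → AffineAveraging.Site (d + 1) → Fin (d + 1) → Fin (d + 1) → ℝ) :
    (∑' x, ∑' y, ∑ κ, ∑ l, F κ x * K x y κ l * F' l y) = ∑ x ∈ s, ∑ y ∈ s', ∑ κ, ∑ l, F κ x * K x y κ l * F' l y := by
  have inner : ∀ x, (∑' y, ∑ κ, ∑ l, F κ x * K x y κ l * F' l y) = ∑ y ∈ s', ∑ κ, ∑ l, F κ x * K x y κ l * F' l y :=
    fun x => tsum_eq_sum (s := s') fun y hy =>
      Finset.sum_eq_zero fun κ _ => Finset.sum_eq_zero fun l _ => by rw [hs' l y hy, mul_zero]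
  rw [tsum_congr inner]
  exact tsum_eq_sum (s := s) fun x hx => Finset.sum_eq_zero fun y _ =>
    Finset.sum_eq_zero fun κ _ => Finset.sum_eq_zero fun l _ => by rw [hs κ x hx, zero_mul, zero_mul]

/-- A finitely supported 1-form is supported in a finite set of sites. [folklore] -/
theorem exists_support_finset (F : Form1 (d + 1) ℝ) (hF : ∀ κ, (Function.support (F κ)).Finite) :
    ∃ s : Finset (AffineAveraging.Site (d + 1)), ∀ κ x, x ∉ s → F κ x = 0 := by
  classical
  refine ⟨Finset.univ.biUnion fun κ => (hF κ).toFinset, fun κ x hx => ?_⟩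
  by_contra h
  exact hx (Finset.mem_biUnion.mpr ⟨κ, Finset.mem_univ κ, (hF κ).mem_toFinset.mpr h⟩)

/-- **(K1aTrans) HOLDS AT EVERY LEVEL `j`: THE FLUCTUATION COVARIANCES COMPOSE ON THE TRANSVERSE SLICE.**
For all finitely supported CO-CLOSED test 1-forms `F`, `F′`,
`⟨F, Γ_{L^{j+1}} F′⟩ = ⟨F, (Γ_{L^j} − [KInv_{L^j} ∘ ι(C^{(j)}) ∘ KInv_{L^j}]_{(inl,inl)}) F′⟩`,
i.e. Balaban's one-step fluctuation covariances at consecutive levels differ, on the physical (gauge-transverse) slice,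
exactly by the transported one-step kernel `C^{(j)} = GQ` sandwiched between the level-`L^j` minimisers `ℋ_{L^j}`.
Proof: both sides are finite sums (`tsum_pair_eq_sum`); by `compA_eq_neg_PQ` the right side is
`Σ F (Γ_M + PQ) F′`; by the TRANSVERSE PAIRING IDENTITY (`pairing_identity`: superposition `V_ζ = Γ_{N′} 𝒬_Mᵀ ζ_{F′}`,
no gauge term for co-closed `ζ_{F′}` (§9.3 `gaugeMult_eq_zero`, §8 (S2)), decomposition `decomposition_of_EL`, (Q) of `Γ`)
and `pair_PQ`, `Σ F (Γ_{N′} − Γ_M) F′ = Σ F PQ F′`. Together with `k1b'` and `k1cNeg` (§6) this completes the K1 trio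
bound BY NAME by the composition layer (lead ruling R26). [folklore] -/
theorem k1aTrans (j : ℕ) : K1aTrans (d := d) Lc j := by
  intro F F' hF hF' hcoF hcoF'
  obtain ⟨s, hs⟩ := exists_support_finset F hF
  obtain ⟨s', hs'⟩ := exists_support_finset F' hF'
  have hN : Lc ^ (j + 1) = Lc ^ j * Lc := pow_succ Lc j
  rw [tsum_pair_eq_sum F F' s s' hs hs'
      (fun x y κ l => KInv (N := Lc ^ (j + 1)) (d := d) x y (Sum.inl κ) (Sum.inl l)),
    tsum_pair_eq_sum F F' s s' hs hs'
      (fun x y κ l => KInv (N := Lc ^ j) (d := d) x y (Sum.inl κ) (Sum.inl l)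
        - comp (KInv (N := Lc ^ j) (d := d))
            (comp (liftW (Lc ^ j) true true (KInvStep (d := d) Lc j)) (KInv (N := Lc ^ j) (d := d)))
            x y (Sum.inl κ) (Sum.inl l))]
  simp only [KInv_inl_inl, compA_eq_neg_PQ, sub_neg_eq_add]
  have key : ∑ x ∈ s, ∑ y ∈ s', ∑ κ, ∑ l,
      F κ x * (Gam (N := Lc ^ (j + 1)) κ x l y - Gam (N := Lc ^ j) κ x l y) * F' l y
        = ∑ x ∈ s, ∑ y ∈ s', ∑ κ, ∑ l, F κ x * PQ (N := Lc ^ (j + 1)) (Lc ^ j) x y κ l * F' l y :=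
    (pairing_identity hN F F' hF' s s' hs hs' hcoF hcoF').trans (pair_PQ (N := Lc ^ (j + 1)) (Lc ^ j) F F' s s').symm
  calc ∑ x ∈ s, ∑ y ∈ s', ∑ κ, ∑ l, F κ x * Gam (N := Lc ^ (j + 1)) κ x l y * F' l y
      = ∑ x ∈ s, ∑ y ∈ s', ∑ κ, ∑ l, (F κ x * (Gam (N := Lc ^ (j + 1)) κ x l y - Gam (N := Lc ^ j) κ x l y) * F' l y
          + F κ x * Gam (N := Lc ^ j) κ x l y * F' l y) :=
        Finset.sum_congr rfl fun x _ => Finset.sum_congr rfl fun y _ => Finset.sum_congr rfl fun κ _ =>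
          Finset.sum_congr rfl fun l _ => by ring
    _ = ∑ x ∈ s, ∑ y ∈ s', ∑ κ, ∑ l, F κ x * (Gam (N := Lc ^ (j + 1)) κ x l y - Gam (N := Lc ^ j) κ x l y) * F' l y
          + ∑ x ∈ s, ∑ y ∈ s', ∑ κ, ∑ l, F κ x * Gam (N := Lc ^ j) κ x l y * F' l y := by
        simp only [Finset.sum_add_distrib]
    _ = ∑ x ∈ s, ∑ y ∈ s', ∑ κ, ∑ l, F κ x * PQ (N := Lc ^ (j + 1)) (Lc ^ j) x y κ l * F' l y
          + ∑ x ∈ s, ∑ y ∈ s', ∑ κ, ∑ l, F κ x * Gam (N := Lc ^ j) κ x l y * F' l y := by rw [key]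
    _ = ∑ x ∈ s, ∑ y ∈ s', ∑ κ, ∑ l, (F κ x * PQ (N := Lc ^ (j + 1)) (Lc ^ j) x y κ l * F' l y
          + F κ x * Gam (N := Lc ^ j) κ x l y * F' l y) := by
        simp only [Finset.sum_add_distrib]
    _ = ∑ x ∈ s, ∑ y ∈ s', ∑ κ, ∑ l, F κ x * (Gam (N := Lc ^ j) κ x l y + PQ (N := Lc ^ (j + 1)) (Lc ^ j) x y κ l)
          * F' l y :=
        Finset.sum_congr rfl fun x _ => Finset.sum_congr rfl fun y _ => Finset.sum_congr rfl fun κ _ =>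
          Finset.sum_congr rfl fun l _ => by ring

/-- **THE K1 TRIO AT EVERY LEVEL** (the three hypotheses the composition layer binds by name, lead ruling R26):
`K1b′ ∧ K1cNeg ∧ K1aTrans` for every `j`. [folklore] -/
theorem k1_trio (j : ℕ) : K1b' (d := d) Lc j ∧ K1cNeg (d := d) Lc j ∧ K1aTrans (d := d) Lc j :=
  ⟨k1b' Lc j, k1cNeg Lc j, k1aTrans Lc j⟩

end StepB

end

end Literature.MathematicalPhysics.QuantumFieldTheory.Balaban1983to89.Beta.ResolventCompositionStepB
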